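import Literature.Analysis.FluidPDE.NovackMatrixKernel
import Literature.Analysis.FluidPDE.DuchonRobertSymmTestFieldProofs
import HarnessLib

/-!
# Novack's tested momentum equation for matrix kernels — discharge of `matSymmTestField_identity`

Topic: Analysis/FluidPDE, proofs companion to `Literature.Analysis.FluidPDE.NovackMatrixKernel`.

Sorry-free proof `Torus.IsDistributionalNSSolutionOn.matSymmTestField_identity_holds` of the named
fact `Torus.IsDistributionalNSSolutionOn.matSymmTestField_identity` (M. Novack, *Scaling laws and
exact results in turbulence*, Nonlinearity 37 (2024) 095002, §2 Step 0: the weak formulation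
(weak:formulation) tested with the matrix-mollified fields `(φ u)^i_M = ∫ φ(x+y)u^j(x+y)T^{ij}(y)φ_{ℓ,γ}(y) dy`
— (setting:up) with "`φⁱ = φuⁱ` … we must justify passing to the limit `φₙⁱ → uⁱ` in each term",
(eq:1) — and with `Uᵏ = φ u^k_M` ((you), (eq:2)), the two identities added). In the tree's
transcription: for a distributional Navier–Stokes/Euler solution `(u, p)` on `T^d × (0,T)` with
`u ∈ L³_{t,x}`, `p ∈ L^{3/2}_{t,x}`, a smooth, even, symmetric matrix kernel `M = (M i j)` and a
scalar test function `ψ` supported in `(0,T)`, the weak formulation holds for the field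
`Φ_M = ψ u_M + (ψ u)_M` (`Torus.matSymmTestField`) with time-derivative pairing `∫∫⟪u, u_M⟫∂ₜψ`:
`∫₀ᵀ∫ ⟪u,u_M⟫∂ₜψ + ∫₀ᵀ∫ ⟪u,(u·∇)Φ_M⟫ + ν∫₀ᵀ∫ ⟪u,ΔΦ_M⟫ + ∫₀ᵀ∫ p div Φ_M = 0`.

## The proof (matrix twin of `Torus.symmTestField_identity_holds`, CCFS 2008 §3.1 time mollification)

`Φ_M` is smooth in space but only `L³` in time. With normalised even time bumps `ρₙ` (radii
`→ 0`, below the distance of `supp ψ` to `{0,T}`), strongly measurable representatives `Uⱼ` of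
the components of `ū = 𝟙_{(0,T)}u`, the extended pressure `p̄` and the space–time mollifications
`𝒮ₙ^{ij} = ⋆_{t,x}(ρₙ ⊗ M i j)` (`Torus.stConv`), we test with the fields of components
`Φₙᵢ = ∑ⱼ [ψ · 𝒮ₙ^{ij}Uⱼ + 𝒮ₙ^{ij}(ψUⱼ)] = ∑ⱼ drTest ρₙ (M i j) ψ Uⱼ`: smooth on
`ℝ × T^d`, compactly supported in `(0,T)` in time (no divergence-freeness needed, the pressure
being explicit). In the resulting identity on `ℝ × T^d` (`Torus.weakForm_rewrite_pressure`):

* the **time-derivative pairing collapses exactly** (`sum_integral_mul_timeDeriv_sum_drTest`):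
  `∂ₜΦₙᵢ = ∑ⱼ [∂ₜψ 𝒮^{ij}Uⱼ + ψ 𝒮'^{ij}Uⱼ + 𝒮'^{ij}(ψUⱼ)]` (`𝒮' = ⋆(ρₙ' ⊗ M i j)`), and by the
  odd–even duality `∫ Uᵢ 𝒮'^{ij}(ψUⱼ) = −∫ ψUⱼ 𝒮'^{ij}Uᵢ` (`Torus.integral_mul_stConv_odd_even`)
  together with the **symmetry `M i j = M j i`** the double sums of the last two terms cancel:
  `∑ᵢ ∫ Uᵢ ∂ₜΦₙᵢ = ∑ᵢⱼ ∫ ∂ₜψ Uᵢ 𝒮ₙ^{ij}Uⱼ` — the weak form of `⟪u,∂ₜu_M⟫ + ⟪u_M,∂ₜu⟫ = ∂ₜ⟪u,u_M⟫`;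
* **all space derivatives converge in `L³(ℝ × T^d)`**: `𝒮ₙ^{ij}F → F ⋆ₓ M i j`
  (`Torus.tendsto_eLpNorm_stConv_sub_sliceConv`) for `F ∈ {Uⱼ, ψUⱼ}` and the kernels `M i j`,
  `∂ₖM i j`, `∂ₖ∂ₖM i j`, finite sums over `j`, against the fixed factors `Uᵢ`, `UᵢUₖ`,
  `p̄ ∈ L^{3/2}` (`Torus.tendsto_integral_mul_of_tendsto_eLpNorm_three`);
* **identification** at a.e. time with the derivatives of `Φ_M(t) = matSymmTestField M (ψ t) (u t)`
  (`Torus.partialDeriv_matSymmTestField`, `laplacian_matSymmTestField_apply`,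
  `divergence_matSymmTestField_eq_sum`) and Fubini back to iterated integrals over `(0,T)`.

## References

* M. Novack, *Scaling laws and exact results in turbulence*, Nonlinearity 37 (2024) 095002 =
  arXiv:2310.01375, §2 Step 0 ((setting:up), (eq:1), (you), (eq:2)). [Novack2024]
* A. Cheskidov, P. Constantin, S. Friedlander, R. Shvydkoy, *Energy conservation and Onsager's
  conjecture for the Euler equations*, Nonlinearity 21 (2008), §3.1 (last paragraph: mollified
  solutions as test functions). [CCFS2008]
* J. Duchon, R. Robert, Nonlinearity 13 (2000) 249–255, proof of Prop. 1, p. 250 (the scalar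
  computation "(NS)·u^ε + (NS^ε)·u"). [DuchonRobert2000]

## Mathlib / tree

Mathlib (this pin): convolution, `ContDiffBump`, Hölder, Fubini; no space–time test-field API.
Tree: `DuchonRobertSymmTestFieldProofs` (`drTest` and its calculus, `integral_cutoff_mul`,
`weakForm_rewrite_pressure`, `stBarScalar`, `tendsto_eLpNorm_stConv_sub_sliceConv`,
`tendsto_eLpNorm_mul_sub_mul`, `tendsto_eLpNorm_add_sub_add`, `tendsto_eLpNorm_finset_sum_sub`),
`OnsagerCCFSTestField` (`stBar`, `vecField`, `sliceConv`, `exists_abs_stConv_le`,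
`integral_mul_stConv_odd_even`, `exists_contDiffBump_seq_lt`,
`tendsto_integral_mul_of_tendsto_eLpNorm_three`, `ae_slice_eq_of_ae_eq_stBar`), `NovackMatrixKernel`
(`matConv`, `matSymmTestField`, `partialDeriv_matSymmTestField`), `DuchonRobertCubicIdentity`
(`inner_convect_eq_sum`), `LerayResolvedEnergyDistributional` (`laplacian_apply_eq`).
-/

noncomputable section

open MeasureTheory TopologicalSpace Set Function Filter Metric
open _root_.Topology
open scoped InnerProductSpace RealInnerProductSpace ENNReal NNReal Convolution ContDiff

namespace Literature.Analysis.FluidPDE.Torus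

variable {d : Type*} [Fintype d]

/-! ## The time-mollified matrix test components and their calculus -/

section MatTest

variable [DecidableEq d]

/-! Throughout, the **time-regularised matrix test component** built from (representatives of) the
velocity components `U j : ℝ × T^d → ℝ`, a smooth even symmetric matrix kernel `M`, a scalar
space–time test function `ψ` and an even time bump `ρ` is the field
`Φᵢ = fun t x => ∑ⱼ drTest ρ (M i j) ψ (U j) t x = ∑ⱼ [ψ · (Uⱼ ⋆_{t,x} (ρ ⊗ M i j)) + (ψUⱼ) ⋆_{t,x} (ρ ⊗ M i j)]`
(written out explicitly in every statement). As `ρ → δ₀` this is the component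
`ψ ∑ⱼ(uⱼ ⋆ M i j) + ∑ⱼ (ψuⱼ) ⋆ M i j` of Novack's field `Φ_M = ψ u_M + (ψu)_M`
(`Torus.matSymmTestField`, Novack 2024 §2 Step 0, (eq:1) + (eq:2)); the time mollification is the
repair of CCFS 2008, §3.1. -/

variable {ρ : ℝ → ℝ} {M : d → d → UnitAddTorus d → ℝ} {ψ : ℝ → UnitAddTorus d → ℝ}
  {U : d → ℝ × UnitAddTorus d → ℝ} {Cψ : ℝ}

omit [DecidableEq d] in
/-- **The matrix test component has a smooth space–time lift** (finite sum of
`Torus.contDiff_stLift_drTest`). [folklore] -/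
theorem contDiff_stLift_sum_drTest (hU : ∀ j, Integrable (U j) ((volume : Measure ℝ).prod volume))
    (hρ : ContDiff ℝ ∞ ρ) (hρc : HasCompactSupport ρ) (hM : ∀ i j, FunctionSpaces.Torus.IsSmooth (M i j))
    (hψs : ContDiff ℝ ∞ (FunctionSpaces.Torus.stLift ψ)) (hψb : ∀ t x, |ψ t x| ≤ Cψ) (i : d) :
    ContDiff ℝ ∞ (FunctionSpaces.Torus.stLift fun t x => ∑ j, drTest ρ (M i j) ψ (U j) t x) := by
  have e : FunctionSpaces.Torus.stLift (fun t x => ∑ j, drTest ρ (M i j) ψ (U j) t x) =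
      fun q => ∑ j, FunctionSpaces.Torus.stLift (drTest ρ (M i j) ψ (U j)) q := by
    funext q; rfl
  rw [e]
  exact ContDiff.sum fun j _ => contDiff_stLift_drTest (hU j) hρ hρc (hM i j) hψs hψb

omit [DecidableEq d] in
/-- **Time support of the matrix test component**: if `ψ(t) = 0` for `t ≤ a` and for `b ≤ t`, and
`ρ` vanishes off `(-δ, δ)` (`δ > 0`), then `Φᵢ t = 0` for `t ≤ a - δ` and for `b + δ ≤ t`. [folklore] -/
theorem sum_drTest_eq_zero_of_dist {a b δ : ℝ} (hδ : 0 < δ) (hψab : ∀ t, (t ≤ a ∨ b ≤ t) → ψ t = 0)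
    (hρδ : ∀ r, ρ r ≠ 0 → |r| < δ) {t : ℝ} (ht : t ≤ a - δ ∨ b + δ ≤ t) (i : d) (x : UnitAddTorus d) :
    ∑ j, drTest ρ (M i j) ψ (U j) t x = 0 :=
  Finset.sum_eq_zero fun _ _ => drTest_eq_zero_of_dist hδ hψab hρδ ht x

omit [DecidableEq d] in
/-- **Time derivative of the matrix test component**:
`∂ₜΦᵢ = ∑ⱼ [∂ₜψ · Wᵢⱼ + ψ · Wᵢⱼ' + Vᵢⱼ']` with `Wᵢⱼ = stConv ρ (M i j) Uⱼ`,
`Wᵢⱼ' = stConv ρ' (M i j) Uⱼ`, `Vᵢⱼ' = stConv ρ' (M i j) (ψUⱼ)`. [folklore] -/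
theorem timeDeriv_sum_drTest (hU : ∀ j, Integrable (U j) ((volume : Measure ℝ).prod volume))
    (hρ : ContDiff ℝ ∞ ρ) (hρc : HasCompactSupport ρ) (hM : ∀ i j, FunctionSpaces.Torus.IsSmooth (M i j))
    (hψs : ContDiff ℝ ∞ (FunctionSpaces.Torus.stLift ψ)) (hψb : ∀ t x, |ψ t x| ≤ Cψ) (i : d) (t : ℝ)
    (x : UnitAddTorus d) :
    FunctionSpaces.Torus.timeDeriv (fun t x => ∑ j, drTest ρ (M i j) ψ (U j) t x) t x =
      ∑ j, (FunctionSpaces.Torus.timeDeriv ψ t x * FunctionSpaces.Torus.stConv ρ (M i j) (U j) t x +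
        ψ t x * FunctionSpaces.Torus.stConv (deriv ρ) (M i j) (U j) t x +
        FunctionSpaces.Torus.stConv (deriv ρ) (M i j) (fun q => ψ q.1 q.2 * U j q) t x) := by
  have h : HasDerivAt (fun τ => ∑ j, drTest ρ (M i j) ψ (U j) τ x)
      (∑ j, FunctionSpaces.Torus.timeDeriv (drTest ρ (M i j) ψ (U j)) t x) t :=
    HasDerivAt.fun_sum (u := Finset.univ) (A := fun j τ => drTest ρ (M i j) ψ (U j) τ x)
      fun j _ => hasDerivAt_timeSlice (contDiff_stLift_drTest (hU j) hρ hρc (hM i j) hψs hψb) t x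
  have h2 : FunctionSpaces.Torus.timeDeriv (fun t x => ∑ j, drTest ρ (M i j) ψ (U j) t x) t x =
      ∑ j, FunctionSpaces.Torus.timeDeriv (drTest ρ (M i j) ψ (U j)) t x := h.deriv
  rw [h2]
  exact Finset.sum_congr rfl fun j _ => timeDeriv_drTest (hU j) hρ hρc (hM i j) hψs hψb t x

/-- **Space derivatives of the matrix test component**:
`∂ₖΦᵢ = ∑ⱼ [∂ₖψ · Wᵢⱼ + ψ · stConv ρ (∂ₖM i j) Uⱼ + stConv ρ (∂ₖM i j) (ψUⱼ)]`. [folklore] -/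
theorem partialDeriv_sum_drTest (hU : ∀ j, Integrable (U j) ((volume : Measure ℝ).prod volume))
    (hρ : ContDiff ℝ ∞ ρ) (hρc : HasCompactSupport ρ) (hM : ∀ i j, FunctionSpaces.Torus.IsSmooth (M i j))
    (hψs : ContDiff ℝ ∞ (FunctionSpaces.Torus.stLift ψ)) (hψb : ∀ t x, |ψ t x| ≤ Cψ) (k i : d) (t : ℝ)
    (x : UnitAddTorus d) :
    FunctionSpaces.Torus.partialDeriv k (fun x => ∑ j, drTest ρ (M i j) ψ (U j) t x) x =
      ∑ j, (FunctionSpaces.Torus.partialDeriv k (ψ t) x * FunctionSpaces.Torus.stConv ρ (M i j) (U j) t x +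
        ψ t x * FunctionSpaces.Torus.stConv ρ (FunctionSpaces.Torus.partialDeriv k (M i j)) (U j) t x +
        FunctionSpaces.Torus.stConv ρ (FunctionSpaces.Torus.partialDeriv k (M i j))
          (fun q => ψ q.1 q.2 * U j q) t x) := by
  have hs : ∀ j, FunctionSpaces.Torus.IsContDiff 1 (drTest ρ (M i j) ψ (U j) t) := fun j =>
    (isSmooth_slice_of_contDiff_stLift (contDiff_stLift_drTest (hU j) hρ hρc (hM i j) hψs hψb) t).isContDiff
      (by simp)
  rw [FunctionSpaces.Torus.partialDeriv_finset_sum _ (fun j _ => hs j)]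
  exact Finset.sum_congr rfl fun j _ => partialDeriv_drTest (hU j) hρ hρc (hM i j) hψs hψb k t x

/-- The first space derivative of the matrix test component, as a function on the torus. [folklore] -/
theorem partialDeriv_sum_drTest_eq (hU : ∀ j, Integrable (U j) ((volume : Measure ℝ).prod volume))
    (hρ : ContDiff ℝ ∞ ρ) (hρc : HasCompactSupport ρ) (hM : ∀ i j, FunctionSpaces.Torus.IsSmooth (M i j))
    (hψs : ContDiff ℝ ∞ (FunctionSpaces.Torus.stLift ψ)) (hψb : ∀ t x, |ψ t x| ≤ Cψ) (k i : d) (t : ℝ) :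
    FunctionSpaces.Torus.partialDeriv k (fun x => ∑ j, drTest ρ (M i j) ψ (U j) t x) =
      fun x => ∑ j, FunctionSpaces.Torus.partialDeriv k (drTest ρ (M i j) ψ (U j) t) x := by
  have hs : ∀ j, FunctionSpaces.Torus.IsContDiff 1 (drTest ρ (M i j) ψ (U j) t) := fun j =>
    (isSmooth_slice_of_contDiff_stLift (contDiff_stLift_drTest (hU j) hρ hρc (hM i j) hψs hψb) t).isContDiff
      (by simp)
  funext x
  rw [FunctionSpaces.Torus.partialDeriv_finset_sum _ (fun j _ => hs j)]

/-- **Second space derivatives of the matrix test component**: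
`∂ₖ∂ₖΦᵢ = ∑ⱼ [∂ₖ∂ₖψ · Wᵢⱼ + 2 ∂ₖψ · stConv ρ (∂ₖM i j) Uⱼ + ψ · stConv ρ (∂ₖ∂ₖM i j) Uⱼ + stConv ρ (∂ₖ∂ₖM i j) (ψUⱼ)]`. [folklore] -/
theorem partialDeriv_partialDeriv_sum_drTest (hU : ∀ j, Integrable (U j) ((volume : Measure ℝ).prod volume))
    (hρ : ContDiff ℝ ∞ ρ) (hρc : HasCompactSupport ρ) (hM : ∀ i j, FunctionSpaces.Torus.IsSmooth (M i j))
    (hψs : ContDiff ℝ ∞ (FunctionSpaces.Torus.stLift ψ)) (hψb : ∀ t x, |ψ t x| ≤ Cψ) (k i : d) (t : ℝ)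
    (x : UnitAddTorus d) :
    FunctionSpaces.Torus.partialDeriv k (FunctionSpaces.Torus.partialDeriv k
        fun x => ∑ j, drTest ρ (M i j) ψ (U j) t x) x =
      ∑ j, (FunctionSpaces.Torus.partialDeriv k (FunctionSpaces.Torus.partialDeriv k (ψ t)) x *
          FunctionSpaces.Torus.stConv ρ (M i j) (U j) t x +
        2 * (FunctionSpaces.Torus.partialDeriv k (ψ t) x *
          FunctionSpaces.Torus.stConv ρ (FunctionSpaces.Torus.partialDeriv k (M i j)) (U j) t x) +
        ψ t x * FunctionSpaces.Torus.stConv ρ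
          (FunctionSpaces.Torus.partialDeriv k (FunctionSpaces.Torus.partialDeriv k (M i j))) (U j) t x +
        FunctionSpaces.Torus.stConv ρ
          (FunctionSpaces.Torus.partialDeriv k (FunctionSpaces.Torus.partialDeriv k (M i j)))
          (fun q => ψ q.1 q.2 * U j q) t x) := by
  have hs' : ∀ j, FunctionSpaces.Torus.IsContDiff 1
      (FunctionSpaces.Torus.partialDeriv k (drTest ρ (M i j) ψ (U j) t)) := fun j =>
    ((isSmooth_slice_of_contDiff_stLift (contDiff_stLift_drTest (hU j) hρ hρc (hM i j) hψs hψb) t).partialDeriv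
      k).isContDiff (by simp)
  rw [partialDeriv_sum_drTest_eq hU hρ hρc hM hψs hψb k i t,
    FunctionSpaces.Torus.partialDeriv_finset_sum _ (fun j _ => hs' j)]
  exact Finset.sum_congr rfl fun j _ =>
    partialDeriv_partialDeriv_drTest (hU j) hρ hρc (hM i j) hψs hψb k t x

/-- **Laplacian of the matrix test component**:
`ΔΦᵢ = ∑ⱼ [Δψ · Wᵢⱼ + 2 ∑ₖ ∂ₖψ · stConv ρ (∂ₖM i j) Uⱼ + ψ · ∑ₖ stConv ρ (∂ₖ∂ₖM i j) Uⱼ + ∑ₖ stConv ρ (∂ₖ∂ₖM i j) (ψUⱼ)]`. [folklore] -/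
theorem laplacian_sum_drTest (hU : ∀ j, Integrable (U j) ((volume : Measure ℝ).prod volume))
    (hρ : ContDiff ℝ ∞ ρ) (hρc : HasCompactSupport ρ) (hM : ∀ i j, FunctionSpaces.Torus.IsSmooth (M i j))
    (hψs : ContDiff ℝ ∞ (FunctionSpaces.Torus.stLift ψ)) (hψb : ∀ t x, |ψ t x| ≤ Cψ) (i : d) (t : ℝ)
    (x : UnitAddTorus d) :
    FunctionSpaces.Torus.laplacian (fun x => ∑ j, drTest ρ (M i j) ψ (U j) t x) x =
      ∑ j, (FunctionSpaces.Torus.laplacian (ψ t) x * FunctionSpaces.Torus.stConv ρ (M i j) (U j) t x +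
        2 * ∑ k, FunctionSpaces.Torus.partialDeriv k (ψ t) x *
          FunctionSpaces.Torus.stConv ρ (FunctionSpaces.Torus.partialDeriv k (M i j)) (U j) t x +
        ψ t x * ∑ k, FunctionSpaces.Torus.stConv ρ
          (FunctionSpaces.Torus.partialDeriv k (FunctionSpaces.Torus.partialDeriv k (M i j))) (U j) t x +
        ∑ k, FunctionSpaces.Torus.stConv ρ
          (FunctionSpaces.Torus.partialDeriv k (FunctionSpaces.Torus.partialDeriv k (M i j)))
          (fun q => ψ q.1 q.2 * U j q) t x) := by
  have hsm : FunctionSpaces.Torus.IsSmooth (fun x => ∑ j, drTest ρ (M i j) ψ (U j) t x) :=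
    isSmooth_slice_of_contDiff_stLift (contDiff_stLift_sum_drTest hU hρ hρc hM hψs hψb i) t
  have hs : ∀ j, FunctionSpaces.Torus.IsSmooth (drTest ρ (M i j) ψ (U j) t) := fun j =>
    isSmooth_slice_of_contDiff_stLift (contDiff_stLift_drTest (hU j) hρ hρc (hM i j) hψs hψb) t
  have hs' : ∀ k j, FunctionSpaces.Torus.IsContDiff 1
      (FunctionSpaces.Torus.partialDeriv k (drTest ρ (M i j) ψ (U j) t)) := fun k j =>
    ((hs j).partialDeriv k).isContDiff (by simp)
  rw [FunctionSpaces.Torus.laplacian_eq_sum_partialDeriv_partialDeriv hsm]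
  calc ∑ k, FunctionSpaces.Torus.partialDeriv k (FunctionSpaces.Torus.partialDeriv k
          fun x => ∑ j, drTest ρ (M i j) ψ (U j) t x) x
      = ∑ k, ∑ j, FunctionSpaces.Torus.partialDeriv k
          (FunctionSpaces.Torus.partialDeriv k (drTest ρ (M i j) ψ (U j) t)) x := by
        refine Finset.sum_congr rfl fun k _ => ?_
        rw [partialDeriv_sum_drTest_eq hU hρ hρc hM hψs hψb k i t,
          FunctionSpaces.Torus.partialDeriv_finset_sum _ (fun j _ => hs' k j)]
    _ = ∑ j, ∑ k, FunctionSpaces.Torus.partialDeriv k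
          (FunctionSpaces.Torus.partialDeriv k (drTest ρ (M i j) ψ (U j) t)) x := Finset.sum_comm
    _ = ∑ j, FunctionSpaces.Torus.laplacian (drTest ρ (M i j) ψ (U j) t) x := by
        refine Finset.sum_congr rfl fun j _ => ?_
        rw [FunctionSpaces.Torus.laplacian_eq_sum_partialDeriv_partialDeriv (hs j)]
    _ = _ := Finset.sum_congr rfl fun j _ => laplacian_drTest (hU j) hρ hρc (hM i j) hψs hψb t x

end MatTest

/-! ## The exact time-derivative pairing of the matrix test components -/

section TimePairing

variable [DecidableEq d]
variable {ρ : ℝ → ℝ} {M : d → d → UnitAddTorus d → ℝ} {ψ : ℝ → UnitAddTorus d → ℝ}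
  {U : d → ℝ × UnitAddTorus d → ℝ} {Cψ Cψ' : ℝ}

omit [DecidableEq d] in
/-- **The time-derivative pairing collapses** (the symmetric structure of Novack's field
`ψ u_M + (ψu)_M`, Novack 2024 §2 Step 0: the sum of (eq:1) and (eq:2) produces `∂ₜ⟪u, u_M⟫`): for
even `ρ` and an even **symmetric** matrix kernel `M`,
`∑ᵢ ∫ Uᵢ ∂ₜΦᵢ = ∑ᵢ ∑ⱼ ∫ Uᵢ ∂ₜψ Wᵢⱼ` with `Wᵢⱼ = stConv ρ (M i j) Uⱼ` — the two double sums
`∑ᵢⱼ ∫ ψ Uᵢ Wᵢⱼ'` and `∑ᵢⱼ ∫ Uᵢ Vᵢⱼ'` (`Wᵢⱼ' = stConv ρ' (M i j) Uⱼ`, `Vᵢⱼ' = stConv ρ' (M i j) (ψUⱼ)`)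
cancel by the odd–even duality `∫ Uᵢ · stConv ρ' (M i j) (ψUⱼ) = -∫ (ψUⱼ) · stConv ρ' (M i j) Uᵢ`
(`Torus.integral_mul_stConv_odd_even`) and the symmetry `M i j = M j i` (exchange of the two
summation indices). [folklore] -/
theorem sum_integral_mul_timeDeriv_sum_drTest (hU : ∀ j, Integrable (U j) ((volume : Measure ℝ).prod volume))
    (hρ : ContDiff ℝ ∞ ρ) (hρc : HasCompactSupport ρ) (hρeven : ∀ r, ρ (-r) = ρ r)
    (hM : ∀ i j, FunctionSpaces.Torus.IsSmooth (M i j)) (hMev : ∀ i j z, M i j (-z) = M i j z)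
    (hMsymm : ∀ i j, M i j = M j i)
    (hψs : ContDiff ℝ ∞ (FunctionSpaces.Torus.stLift ψ)) (hψb : ∀ t x, |ψ t x| ≤ Cψ)
    (hψ'c : Continuous (uncurry (FunctionSpaces.Torus.timeDeriv ψ)))
    (hψ'b : ∀ t x, |FunctionSpaces.Torus.timeDeriv ψ t x| ≤ Cψ') :
    ∑ i, ∫ q, U i q * FunctionSpaces.Torus.timeDeriv (fun t x => ∑ j, drTest ρ (M i j) ψ (U j) t x) q.1 q.2
        ∂((volume : Measure ℝ).prod volume) =
      ∑ i, ∑ j, ∫ q, U i q * (FunctionSpaces.Torus.timeDeriv ψ q.1 q.2 *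
        FunctionSpaces.Torus.stConv ρ (M i j) (U j) q.1 q.2) ∂((volume : Measure ℝ).prod volume) := by
  set μ : Measure (ℝ × UnitAddTorus d) := (volume : Measure ℝ).prod volume with hμ
  have hψc : Continuous (uncurry ψ) := FunctionSpaces.Torus.continuous_uncurry_of_continuous_stLift hψs.continuous
  have hΨ : ∀ j, Integrable (fun q : ℝ × UnitAddTorus d => ψ q.1 q.2 * U j q) μ := fun j =>
    integrable_cutoff_mul (hU j) hψc hψb
  have hρ' : ContDiff ℝ ∞ (deriv ρ) := hρ.deriv'
  have hρ'c : Continuous (deriv ρ) := hρ.continuous_deriv (by simp)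
  -- the three families of mollified fields and their bounds / continuity
  set W : d → d → ℝ → UnitAddTorus d → ℝ := fun i j => FunctionSpaces.Torus.stConv ρ (M i j) (U j) with hW
  set W' : d → d → ℝ → UnitAddTorus d → ℝ := fun i j =>
    FunctionSpaces.Torus.stConv (deriv ρ) (M i j) (U j) with hW'
  set V' : d → d → ℝ → UnitAddTorus d → ℝ := fun i j =>
    FunctionSpaces.Torus.stConv (deriv ρ) (M i j) (fun q => ψ q.1 q.2 * U j q) with hV'
  have hWc : ∀ i j, Continuous (uncurry (W i j)) := fun i j =>
    FunctionSpaces.Torus.continuous_uncurry_of_continuous_stLift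
      (FunctionSpaces.Torus.contDiff_top_stLift_stConv (hU j) hρ hρc (hM i j)).continuous
  have hW'c : ∀ i j, Continuous (uncurry (W' i j)) := fun i j =>
    FunctionSpaces.Torus.continuous_uncurry_of_continuous_stLift
      (FunctionSpaces.Torus.contDiff_top_stLift_stConv (hU j) hρ' hρc.deriv (hM i j)).continuous
  have hV'c : ∀ i j, Continuous (uncurry (V' i j)) := fun i j =>
    FunctionSpaces.Torus.continuous_uncurry_of_continuous_stLift
      (FunctionSpaces.Torus.contDiff_top_stLift_stConv (hΨ j) hρ' hρc.deriv (hM i j)).continuous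
  -- integrability of the three pairings
  have I1 : ∀ i j, Integrable (fun q : ℝ × UnitAddTorus d =>
      U i q * (FunctionSpaces.Torus.timeDeriv ψ q.1 q.2 * W i j q.1 q.2)) μ := fun i j => by
    obtain ⟨M₀, hM₀⟩ := exists_abs_stConv_le (hU j) hρ.continuous hρc (hM i j).continuous
    exact (hU i).mul_bdd (c := Cψ' * M₀) (hψ'c.mul (hWc i j)).aestronglyMeasurable
      (Eventually.of_forall fun q => by
        rw [norm_mul, Real.norm_eq_abs, Real.norm_eq_abs]
        exact mul_le_mul (hψ'b _ _) (hM₀ _ _) (abs_nonneg _) ((abs_nonneg _).trans (hψ'b 0 0)))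
  have I2 : ∀ i j, Integrable (fun q : ℝ × UnitAddTorus d => ψ q.1 q.2 * U i q * W' i j q.1 q.2) μ :=
    fun i j => by
    obtain ⟨M₁, hM₁⟩ := exists_abs_stConv_le (hU j) hρ'c hρc.deriv (hM i j).continuous
    exact (hΨ i).mul_bdd (c := M₁) (hW'c i j).aestronglyMeasurable (Eventually.of_forall fun q => by
      rw [Real.norm_eq_abs]; exact hM₁ _ _)
  have I3 : ∀ i j, Integrable (fun q : ℝ × UnitAddTorus d => U i q * V' i j q.1 q.2) μ := fun i j => by
    obtain ⟨M₂, hM₂⟩ := exists_abs_stConv_le (hΨ j) hρ'c hρc.deriv (hM i j).continuous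
    exact (hU i).mul_bdd (c := M₂) (hV'c i j).aestronglyMeasurable (Eventually.of_forall fun q => by
      rw [Real.norm_eq_abs]; exact hM₂ _ _)
  -- expand the time derivative and split the integrals
  have hexp : ∀ i, (fun q : ℝ × UnitAddTorus d =>
      U i q * FunctionSpaces.Torus.timeDeriv (fun t x => ∑ j, drTest ρ (M i j) ψ (U j) t x) q.1 q.2) =
      fun q => ∑ j, (U i q * (FunctionSpaces.Torus.timeDeriv ψ q.1 q.2 * W i j q.1 q.2) +
        (ψ q.1 q.2 * U i q * W' i j q.1 q.2 + U i q * V' i j q.1 q.2)) := by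
    intro i
    funext q
    rw [timeDeriv_sum_drTest hU hρ hρc hM hψs hψb i q.1 q.2, Finset.mul_sum]
    refine Finset.sum_congr rfl fun j _ => ?_
    simp only [hW, hW', hV']
    ring
  have I23 : ∀ i j, Integrable (fun q : ℝ × UnitAddTorus d =>
      ψ q.1 q.2 * U i q * W' i j q.1 q.2 + U i q * V' i j q.1 q.2) μ := fun i j => (I2 i j).add (I3 i j)
  have I123 : ∀ i j, Integrable (fun q : ℝ × UnitAddTorus d =>
      U i q * (FunctionSpaces.Torus.timeDeriv ψ q.1 q.2 * W i j q.1 q.2) +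
        (ψ q.1 q.2 * U i q * W' i j q.1 q.2 + U i q * V' i j q.1 q.2)) μ := fun i j => (I1 i j).add (I23 i j)
  have hsplit : ∀ i, ∫ q, U i q *
      FunctionSpaces.Torus.timeDeriv (fun t x => ∑ j, drTest ρ (M i j) ψ (U j) t x) q.1 q.2 ∂μ =
      ∑ j, ∫ q, U i q * (FunctionSpaces.Torus.timeDeriv ψ q.1 q.2 * W i j q.1 q.2) ∂μ +
        (∑ j, ∫ q, ψ q.1 q.2 * U i q * W' i j q.1 q.2 ∂μ + ∑ j, ∫ q, U i q * V' i j q.1 q.2 ∂μ) := by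
    intro i
    rw [hexp i, integral_finsetSum _ fun j _ => I123 i j]
    rw [← Finset.sum_add_distrib, ← Finset.sum_add_distrib]
    refine Finset.sum_congr rfl fun j _ => ?_
    rw [integral_add (I1 i j) (I23 i j), integral_add (I2 i j) (I3 i j)]
  simp_rw [hsplit]
  rw [Finset.sum_add_distrib, Finset.sum_add_distrib]
  -- the cancellation of the double sums
  have hdual : ∀ i j, ∫ q, U i q * V' i j q.1 q.2 ∂μ = -∫ q, ψ q.1 q.2 * U j q * W' j i q.1 q.2 ∂μ := by
    intro i j
    simp only [hV', hW']
    rw [integral_mul_stConv_odd_even (hU i) (hΨ j) hρ'c hρc.deriv (FunctionSpaces.deriv_neg_of_even hρeven)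
      (hM i j).continuous (hMev i j), hMsymm i j]
  have hcancel : ∑ i, ∑ j, ∫ q, U i q * V' i j q.1 q.2 ∂μ = -∑ i, ∑ j, ∫ q, ψ q.1 q.2 * U i q * W' i j q.1 q.2 ∂μ := by
    simp_rw [hdual]
    rw [Finset.sum_comm]
    simp only [Finset.sum_neg_distrib]
  rw [hcancel, add_neg_cancel, add_zero]

end TimePairing

/-! ## Smoothness and derivatives of Novack's symmetric matrix field on a time slice -/

section SliceFormulas

variable [DecidableEq d] {M : d → d → UnitAddTorus d → ℝ} {χ : UnitAddTorus d → ℝ}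
  {v : UnitAddTorus d → EuclideanSpace ℝ d}

omit [DecidableEq d] in
/-- The matrix mollification of an integrable field by a smooth matrix kernel is smooth
(componentwise finite sums of `Torus.isSmooth_convolution`). [folklore] -/
theorem isSmooth_matConv (hM : ∀ i j, FunctionSpaces.Torus.IsSmooth (M i j)) (hv : Integrable v volume) :
    FunctionSpaces.Torus.IsSmooth (matConv v M) := by
  have hvj : ∀ j, Integrable (fun y => v y j) volume := fun j => hv.eval_piLp j
  rw [FunctionSpaces.Torus.IsSmooth, contDiff_euclidean]
  intro i
  have hl : (fun w => FunctionSpaces.Torus.lift (matConv v M) w i) =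
      fun w => ∑ j, FunctionSpaces.Torus.lift ((fun z => v z j) ⋆ M i j) w := by
    funext w; rfl
  rw [hl]
  exact ContDiff.sum fun j _ => FunctionSpaces.Torus.isSmooth_convolution (hvj j) (hM i j)

omit [DecidableEq d] in
/-- Novack's symmetric matrix field of an integrable field, a smooth matrix kernel and a smooth
cut-off is smooth. [folklore] -/
theorem isSmooth_matSymmTestField (hM : ∀ i j, FunctionSpaces.Torus.IsSmooth (M i j))
    (hχ : FunctionSpaces.Torus.IsSmooth χ) (hv : Integrable v volume) :
    FunctionSpaces.Torus.IsSmooth (matSymmTestField M χ v) := by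
  have h1 : FunctionSpaces.Torus.IsSmooth (matConv v M) := isSmooth_matConv hM hv
  have h2 : FunctionSpaces.Torus.IsSmooth (matConv (fun y => χ y • v y) M) :=
    isSmooth_matConv hM (hχ.integrable_smul hv)
  exact (hχ.smul' h1).add h2

/-- Second derivatives of the components of the symmetric matrix field:
`∂ₖ∂ₖ(Φ_M)ᵢ = ∂ₖ∂ₖχ ∑ⱼ(vⱼ ⋆ M i j) + 2 ∂ₖχ ∑ⱼ(vⱼ ⋆ ∂ₖM i j) + χ ∑ⱼ(vⱼ ⋆ ∂ₖ∂ₖM i j) + ∑ⱼ (χvⱼ) ⋆ ∂ₖ∂ₖM i j`. [folklore] -/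
theorem partialDeriv_partialDeriv_matSymmTestField (hM : ∀ i j, FunctionSpaces.Torus.IsSmooth (M i j))
    (hχ : FunctionSpaces.Torus.IsSmooth χ) (hv : Integrable v volume) (k i : d) (x : UnitAddTorus d) :
    FunctionSpaces.Torus.partialDeriv k (FunctionSpaces.Torus.partialDeriv k (fun y => matSymmTestField M χ v y i)) x =
      FunctionSpaces.Torus.partialDeriv k (FunctionSpaces.Torus.partialDeriv k χ) x *
          (∑ j, ((fun z => v z j) ⋆ M i j) x) +
        2 * (FunctionSpaces.Torus.partialDeriv k χ x *
          (∑ j, ((fun z => v z j) ⋆ FunctionSpaces.Torus.partialDeriv k (M i j)) x)) +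
        χ x * (∑ j, ((fun z => v z j) ⋆
          FunctionSpaces.Torus.partialDeriv k (FunctionSpaces.Torus.partialDeriv k (M i j))) x) +
        ∑ j, ((fun z => χ z * v z j) ⋆
          FunctionSpaces.Torus.partialDeriv k (FunctionSpaces.Torus.partialDeriv k (M i j))) x := by
  have hvj : ∀ j, Integrable (fun z => v z j) volume := fun j => hv.eval_piLp j
  have hχvj : ∀ j, Integrable (fun z => χ z * v z j) volume := fun j => hχ.integrable_smul (hvj j)
  have hMk : ∀ j, FunctionSpaces.Torus.IsSmooth (FunctionSpaces.Torus.partialDeriv k (M i j)) := fun j =>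
    (hM i j).partialDeriv k
  -- the first derivative, as a function on the torus
  have h1 : FunctionSpaces.Torus.partialDeriv k (fun y => matSymmTestField M χ v y i) =
      (fun x => FunctionSpaces.Torus.partialDeriv k χ x * (∑ j, ((fun z => v z j) ⋆ M i j) x) +
        χ x * (∑ j, ((fun z => v z j) ⋆ FunctionSpaces.Torus.partialDeriv k (M i j)) x)) +
        fun x => ∑ j, ((fun z => χ z * v z j) ⋆ FunctionSpaces.Torus.partialDeriv k (M i j)) x := by
    funext y
    rw [Pi.add_apply, partialDeriv_matSymmTestField hM hχ hv k i y]
  -- smoothness of the pieces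
  have hs1 : ∀ j, FunctionSpaces.Torus.IsSmooth ((fun z => v z j) ⋆ M i j) := fun j =>
    FunctionSpaces.Torus.isSmooth_convolution (hvj j) (hM i j)
  have hs2 : ∀ j, FunctionSpaces.Torus.IsSmooth ((fun z => v z j) ⋆ FunctionSpaces.Torus.partialDeriv k (M i j)) :=
    fun j => FunctionSpaces.Torus.isSmooth_convolution (hvj j) (hMk j)
  have hs3 : ∀ j, FunctionSpaces.Torus.IsSmooth
      ((fun z => χ z * v z j) ⋆ FunctionSpaces.Torus.partialDeriv k (M i j)) := fun j =>
    FunctionSpaces.Torus.isSmooth_convolution (hχvj j) (hMk j)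
  have hsum : ∀ {g : d → UnitAddTorus d → ℝ}, (∀ j, FunctionSpaces.Torus.IsSmooth (g j)) →
      FunctionSpaces.Torus.IsSmooth (fun y => ∑ j, g j y) := by
    intro g hg
    have hl : FunctionSpaces.Torus.lift (fun y => ∑ j, g j y) =
        fun w => ∑ j, FunctionSpaces.Torus.lift (g j) w := rfl
    unfold FunctionSpaces.Torus.IsSmooth
    rw [hl]
    exact ContDiff.sum fun j _ => hg j
  have hW : FunctionSpaces.Torus.IsSmooth (fun y => ∑ j, ((fun z => v z j) ⋆ M i j) y) := hsum hs1
  have hWd : FunctionSpaces.Torus.IsSmooth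
      (fun y => ∑ j, ((fun z => v z j) ⋆ FunctionSpaces.Torus.partialDeriv k (M i j)) y) := hsum hs2
  have hVd : FunctionSpaces.Torus.IsSmooth
      (fun y => ∑ j, ((fun z => χ z * v z j) ⋆ FunctionSpaces.Torus.partialDeriv k (M i j)) y) := hsum hs3
  have hχk : FunctionSpaces.Torus.IsSmooth (FunctionSpaces.Torus.partialDeriv k χ) := hχ.partialDeriv k
  have hA : FunctionSpaces.Torus.IsContDiff 1
      (fun x => FunctionSpaces.Torus.partialDeriv k χ x * (∑ j, ((fun z => v z j) ⋆ M i j) x)) :=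
    (hχk.smul' hW).isContDiff (by simp)
  have hB : FunctionSpaces.Torus.IsContDiff 1
      (fun x => χ x * (∑ j, ((fun z => v z j) ⋆ FunctionSpaces.Torus.partialDeriv k (M i j)) x)) :=
    (hχ.smul' hWd).isContDiff (by simp)
  have hAB : FunctionSpaces.Torus.IsContDiff 1
      (fun x => FunctionSpaces.Torus.partialDeriv k χ x * (∑ j, ((fun z => v z j) ⋆ M i j) x) +
        χ x * (∑ j, ((fun z => v z j) ⋆ FunctionSpaces.Torus.partialDeriv k (M i j)) x)) := hA.add hB
  have hAB' : (fun x => FunctionSpaces.Torus.partialDeriv k χ x * (∑ j, ((fun z => v z j) ⋆ M i j) x) +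
        χ x * (∑ j, ((fun z => v z j) ⋆ FunctionSpaces.Torus.partialDeriv k (M i j)) x)) =
      (fun x => FunctionSpaces.Torus.partialDeriv k χ x * (∑ j, ((fun z => v z j) ⋆ M i j) x)) +
        fun x => χ x * (∑ j, ((fun z => v z j) ⋆ FunctionSpaces.Torus.partialDeriv k (M i j)) x) := by
    funext y; rfl
  rw [h1, FunctionSpaces.Torus.partialDeriv_add hAB (hVd.isContDiff (by simp)), Pi.add_apply, hAB',
    FunctionSpaces.Torus.partialDeriv_add hA hB, Pi.add_apply,
    FunctionSpaces.Torus.partialDeriv_mul (hχk.isContDiff (by simp)) (hW.isContDiff (by simp)),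
    FunctionSpaces.Torus.partialDeriv_mul (hχ.isContDiff (by simp)) (hWd.isContDiff (by simp)),
    FunctionSpaces.Torus.partialDeriv_finset_sum _ (fun j _ => (hs1 j).isContDiff (by simp)),
    FunctionSpaces.Torus.partialDeriv_finset_sum _ (fun j _ => (hs2 j).isContDiff (by simp)),
    FunctionSpaces.Torus.partialDeriv_finset_sum _ (fun j _ => (hs3 j).isContDiff (by simp))]
  simp_rw [FunctionSpaces.Torus.partialDeriv_convolution (hvj _) (hM i _),
    FunctionSpaces.Torus.partialDeriv_convolution (hvj _) (hMk _),
    FunctionSpaces.Torus.partialDeriv_convolution (hχvj _) (hMk _)]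
  ring

/-- First derivatives of the components of the symmetric matrix field, summed over the kernel
index last: `∂ₖ(Φ_M)ᵢ = ∑ⱼ [∂ₖχ (vⱼ ⋆ M i j) + χ (vⱼ ⋆ ∂ₖM i j) + (χvⱼ) ⋆ ∂ₖM i j]`. [folklore] -/
theorem partialDeriv_matSymmTestField_eq_sum (hM : ∀ i j, FunctionSpaces.Torus.IsSmooth (M i j))
    (hχ : FunctionSpaces.Torus.IsSmooth χ) (hv : Integrable v volume) (k i : d) (x : UnitAddTorus d) :
    FunctionSpaces.Torus.partialDeriv k (fun y => matSymmTestField M χ v y i) x =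
      ∑ j, (FunctionSpaces.Torus.partialDeriv k χ x * ((fun z => v z j) ⋆ M i j) x +
        χ x * ((fun z => v z j) ⋆ FunctionSpaces.Torus.partialDeriv k (M i j)) x +
        ((fun z => χ z * v z j) ⋆ FunctionSpaces.Torus.partialDeriv k (M i j)) x) := by
  rw [partialDeriv_matSymmTestField hM hχ hv k i x, Finset.mul_sum, Finset.mul_sum,
    ← Finset.sum_add_distrib, ← Finset.sum_add_distrib]

/-- **Laplacian of the components of the symmetric matrix field**:
`Δ(Φ_M)ᵢ = ∑ⱼ [Δχ (vⱼ ⋆ M i j) + 2 ∑ₖ ∂ₖχ (vⱼ ⋆ ∂ₖM i j) + χ ∑ₖ (vⱼ ⋆ ∂ₖ∂ₖM i j) + ∑ₖ (χvⱼ) ⋆ ∂ₖ∂ₖM i j]`. [folklore] -/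
theorem laplacian_matSymmTestField_apply (hM : ∀ i j, FunctionSpaces.Torus.IsSmooth (M i j))
    (hχ : FunctionSpaces.Torus.IsSmooth χ) (hv : Integrable v volume) (i : d) (x : UnitAddTorus d) :
    FunctionSpaces.Torus.laplacian (fun y => matSymmTestField M χ v y i) x =
      ∑ j, (FunctionSpaces.Torus.laplacian χ x * ((fun z => v z j) ⋆ M i j) x +
        2 * ∑ k, FunctionSpaces.Torus.partialDeriv k χ x *
          ((fun z => v z j) ⋆ FunctionSpaces.Torus.partialDeriv k (M i j)) x +
        χ x * ∑ k, ((fun z => v z j) ⋆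
          FunctionSpaces.Torus.partialDeriv k (FunctionSpaces.Torus.partialDeriv k (M i j))) x +
        ∑ k, ((fun z => χ z * v z j) ⋆
          FunctionSpaces.Torus.partialDeriv k (FunctionSpaces.Torus.partialDeriv k (M i j))) x) := by
  have hs : FunctionSpaces.Torus.IsSmooth (fun y => matSymmTestField M χ v y i) :=
    (EuclideanSpace.proj (𝕜 := ℝ) i).contDiff.comp (isSmooth_matSymmTestField hM hχ hv)
  rw [FunctionSpaces.Torus.laplacian_eq_sum_partialDeriv_partialDeriv hs,
    FunctionSpaces.Torus.laplacian_eq_sum_partialDeriv_partialDeriv hχ]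
  simp_rw [partialDeriv_partialDeriv_matSymmTestField hM hχ hv]
  simp only [Finset.mul_sum, Finset.sum_mul, Finset.sum_add_distrib]
  refine congrArg₂ _ (congrArg₂ _ (congrArg₂ _ ?_ ?_) ?_) ?_ <;> exact Finset.sum_comm

/-- The Laplacian pairing of the symmetric matrix field, componentwise: `⟪w, ΔΦ_M⟫ = ∑ᵢ wᵢ Δ(Φ_M)ᵢ`. [folklore] -/
theorem inner_laplacian_matSymmTestField_eq_sum (hM : ∀ i j, FunctionSpaces.Torus.IsSmooth (M i j))
    (hχ : FunctionSpaces.Torus.IsSmooth χ) (hv : Integrable v volume) (w : EuclideanSpace ℝ d)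
    (x : UnitAddTorus d) :
    ⟪w, FunctionSpaces.Torus.laplacian (matSymmTestField M χ v) x⟫ =
      ∑ i, w i * FunctionSpaces.Torus.laplacian (fun y => matSymmTestField M χ v y i) x := by
  rw [PiLp.inner_apply]
  refine Finset.sum_congr rfl fun i _ => ?_
  rw [laplacian_apply_eq (isSmooth_matSymmTestField hM hχ hv) x i]
  simp [mul_comm]

/-- The divergence of the symmetric matrix field through `vⱼ ⋆ ∂ᵢ(M i j)` (no divergence-freeness
used): `div Φ_M = ∑ᵢ [∂ᵢχ ∑ⱼ(vⱼ ⋆ M i j) + χ ∑ⱼ(vⱼ ⋆ ∂ᵢM i j) + ∑ⱼ (χvⱼ) ⋆ ∂ᵢM i j]`. [folklore] -/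
theorem divergence_matSymmTestField_eq_sum (hM : ∀ i j, FunctionSpaces.Torus.IsSmooth (M i j))
    (hχ : FunctionSpaces.Torus.IsSmooth χ) (hv : Integrable v volume) (x : UnitAddTorus d) :
    FunctionSpaces.Torus.divergence (matSymmTestField M χ v) x =
      ∑ i, ∑ j, (FunctionSpaces.Torus.partialDeriv i χ x * ((fun z => v z j) ⋆ M i j) x +
        χ x * ((fun z => v z j) ⋆ FunctionSpaces.Torus.partialDeriv i (M i j)) x +
        ((fun z => χ z * v z j) ⋆ FunctionSpaces.Torus.partialDeriv i (M i j)) x) := by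
  unfold FunctionSpaces.Torus.divergence
  exact Finset.sum_congr rfl fun i _ => partialDeriv_matSymmTestField_eq_sum hM hχ hv i i x

end SliceFormulas

end Literature.Analysis.FluidPDE.Torus

namespace Literature.Analysis.FluidPDE.Torus

variable {d : Type*} [Fintype d]

/-! ## The discharge of `matSymmTestField_identity` -/

section Discharge

variable [DecidableEq d]

/-- **Discharge of `Torus.IsDistributionalNSSolutionOn.matSymmTestField_identity`** (Novack 2024, §2
Step 0: the weak formulation tested with `(φu)_M` ((eq:1), "we claim that we can actually choose
`φⁱ = φuⁱ` … we must justify passing to the limit `φₙⁱ → uⁱ` in each term") and with `φ u_M`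
((eq:2)), added — the tested momentum equation for Novack's symmetric matrix field
`Φ_M = ψ u_M + (ψu)_M`; its justification for weak solutions is the time-mollification argument of
CCFS 2008, §3.1, here with the test fields of components
`Φₙᵢ = ∑ⱼ [ψ · (ūⱼ ⋆_{t,x} (ρₙ ⊗ M i j)) + (ψ ūⱼ) ⋆_{t,x} (ρₙ ⊗ M i j)]` — smooth, compactly
supported in `(0,T)` — whose time-derivative pairing is *exactly* `∑ᵢⱼ ∫∫ ∂ₜψ ūᵢ (ūⱼ ⋆ (ρₙ ⊗ M i j))`
(`sum_integral_mul_timeDeriv_sum_drTest`: odd–even duality and the symmetry of `M`), and whose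
space derivatives converge in `L³(ℝ × T^d)` to those of `Φ_M` (space–time mollification →
slice-wise mollification, `tendsto_eLpNorm_stConv_sub_sliceConv`) against the fixed factors `ūᵢ`,
`ūᵢūₖ`, `p̄ ∈ L^{3/2}`). [cite: Novack2024, Sect. 2 Step 0 (eq:1)–(eq:2)] -/
theorem IsDistributionalNSSolutionOn.matSymmTestField_identity_holds :
    IsDistributionalNSSolutionOn.matSymmTestField_identity (d := d) := by
  intro T ν u p hsol hu3 hp M hM hMev hMsymm ψ hψ
  -- degenerate time interval
  rcases le_or_gt T 0 with hT | hT
  · simp [Ioo_eq_empty_of_le hT, Measure.restrict_empty]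
  set μ : Measure (ℝ × UnitAddTorus d) := (volume : Measure ℝ).prod volume with hμ
  have hMc : ∀ i j, Continuous (M i j) := fun i j => (hM i j).continuous
  ------------------------------------------------------------------ ψ data
  obtain ⟨⟨hψst, b, hbT, hψb0⟩, a, ha, hψa0⟩ := hψ
  have hψab : ∀ t, (t ≤ a ∨ b ≤ t) → ψ t = 0 := fun t ht => by
    rcases ht with ht | ht
    · exact hψa0 t ht
    · exact hψb0 t ht
  have hψ' : FunctionSpaces.Torus.IsSpaceTimeTestIoo T ψ := ⟨⟨hψst, b, hbT, hψb0⟩, a, ha, hψa0⟩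
  obtain ⟨hψsm, hdtsm, -, -⟩ := hψ'.isSpaceTimeTest.isSmoothSpaceTimeOn_derived
  have hψdi : ∀ i, FunctionSpaces.Torus.IsSmoothSpaceTimeOn univ (fun t => FunctionSpaces.Torus.partialDeriv i (ψ t)) :=
    fun i => hψsm.partialDeriv uniqueDiffOn_univ i
  have hψL : FunctionSpaces.Torus.IsSmoothSpaceTimeOn univ (fun t => FunctionSpaces.Torus.laplacian (ψ t)) :=
    hψsm.laplacian uniqueDiffOn_univ
  -- vanishing off `[a - 1, b + 1]`
  have hψ0 : ∀ t, t ∉ Icc (a - 1) (b + 1) → ψ t = 0 := fun t ht => by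
    refine hψab t ?_
    rcases lt_or_ge t (a - 1) with h | h
    · left; linarith
    · right
      by_contra h'
      exact ht ⟨h, by linarith [not_le.1 h']⟩
  have hψ0' : ∀ t, t ∉ Icc (a - 1) (b + 1) → ∀ᶠ τ in 𝓝 t, ψ τ = 0 := fun t ht => by
    rcases lt_or_ge t (a - 1) with h | h
    · filter_upwards [Iio_mem_nhds (show t < a by linarith)] with τ hτ
      exact hψab τ (Or.inl (le_of_lt hτ))
    · have hb' : b + 1 < t := by
        by_contra h'
        exact ht ⟨h, not_lt.1 h'⟩
      filter_upwards [Ioi_mem_nhds (show b < t by linarith)] with τ hτ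
      exact hψab τ (Or.inr (le_of_lt hτ))
  have hdt0 : ∀ t, t ∉ Icc (a - 1) (b + 1) → FunctionSpaces.Torus.timeDeriv ψ t = 0 := fun t ht => by
    funext x
    have hev : (fun τ => ψ τ x) =ᶠ[𝓝 t] fun _ => (0 : ℝ) := by
      filter_upwards [hψ0' t ht] with τ hτ
      rw [hτ, Pi.zero_apply]
    show deriv (fun τ => ψ τ x) t = 0
    rw [hev.deriv_eq, deriv_const]
  have hdi0 : ∀ i t, t ∉ Icc (a - 1) (b + 1) → (fun t => FunctionSpaces.Torus.partialDeriv i (ψ t)) t = 0 := fun i t ht => by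
    funext x
    show FunctionSpaces.Torus.partialDeriv i (ψ t) x = 0
    rw [hψ0 t ht]
    exact partialDeriv_zero_fun i x
  have hL0 : ∀ t, t ∉ Icc (a - 1) (b + 1) → (fun t => FunctionSpaces.Torus.laplacian (ψ t)) t = 0 := fun t ht => by
    funext x
    show FunctionSpaces.Torus.laplacian (ψ t) x = 0
    rw [hψ0 t ht]
    exact laplacian_zero_fun x
  -- global bounds and continuity
  obtain ⟨Cψ, -, hCψ⟩ := exists_forall_norm_le_of_isSmoothSpaceTimeOn hψsm hψ0
  obtain ⟨Cψt, -, hCψt⟩ := exists_forall_norm_le_of_isSmoothSpaceTimeOn hdtsm hdt0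
  choose Cψi hCψi0 hCψi using fun i => exists_forall_norm_le_of_isSmoothSpaceTimeOn (hψdi i) (hdi0 i)
  obtain ⟨CψL, -, hCψL⟩ := exists_forall_norm_le_of_isSmoothSpaceTimeOn hψL hL0
  have hψb : ∀ t x, |ψ t x| ≤ Cψ := fun t x => by rw [← Real.norm_eq_abs]; exact hCψ t x
  have hψtb : ∀ t x, |FunctionSpaces.Torus.timeDeriv ψ t x| ≤ Cψt := fun t x => by rw [← Real.norm_eq_abs]; exact hCψt t x
  have hψib : ∀ i t x, |FunctionSpaces.Torus.partialDeriv i (ψ t) x| ≤ Cψi i := fun i t x => by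
    rw [← Real.norm_eq_abs]; exact hCψi i t x
  have hψLb : ∀ t x, |FunctionSpaces.Torus.laplacian (ψ t) x| ≤ CψL := fun t x => by rw [← Real.norm_eq_abs]; exact hCψL t x
  have hψc : Continuous (uncurry ψ) := hψsm.continuous_uncurry
  have hψtc : Continuous (uncurry (FunctionSpaces.Torus.timeDeriv ψ)) := hdtsm.continuous_uncurry
  have hψic : ∀ i, Continuous (uncurry fun t x => FunctionSpaces.Torus.partialDeriv i (ψ t) x) := fun i =>
    (hψdi i).continuous_uncurry
  have hψLc : Continuous (uncurry fun t x => FunctionSpaces.Torus.laplacian (ψ t) x) := hψL.continuous_uncurry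
  have hψslice : ∀ t, FunctionSpaces.Torus.IsSmooth (ψ t) := fun t => isSmooth_slice_of_contDiff_stLift hψst t
  ------------------------------------------------------------------ time bumps
  set δ₀ : ℝ := min a (T - b) / 2 with hδ₀
  have hmin : 0 < min a (T - b) := lt_min ha (by linarith)
  have hδ₀pos : 0 < δ₀ := by positivity
  have hδ₀a : 0 < a - δ₀ := by
    have := min_le_left a (T - b); rw [hδ₀]; linarith
  have hδ₀b : b + δ₀ < T := by
    have := min_le_right a (T - b); rw [hδ₀]; linarith
  obtain ⟨φ, hφlt, hφ0⟩ := exists_contDiffBump_seq_lt hδ₀pos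
  set ρ : ℕ → ℝ → ℝ := fun n => (φ n).normed volume with hρdef
  have hρs : ∀ n, ContDiff ℝ ∞ (ρ n) := fun n => (φ n).contDiff_normed
  have hρc : ∀ n, HasCompactSupport (ρ n) := fun n => (φ n).hasCompactSupport_normed
  have hρcont : ∀ n, Continuous (ρ n) := fun n => (φ n).continuous_normed
  have hρeven : ∀ n r, ρ n (-r) = ρ n r := fun n r => (φ n).normed_neg r
  have hρsupp : ∀ n r, ρ n r ≠ 0 → |r| < δ₀ := fun n r h =>
    (abs_lt_of_normed_ne_zero (φ n) h).trans (hφlt n)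
  ------------------------------------------------------------------ velocity and pressure data
  have hm : AEStronglyMeasurable (uncurry u) ((volume.restrict (Ioo 0 T)).prod volume) :=
    aestronglyMeasurable_uncurry_prod hsol.1
  have hbar1 : Integrable (stBar T u) μ := integrable_stBar hm hsol.2.1
  have hbar2 : MemLp (stBar T u) 2 μ := by
    have := memLp_stBar hm two_ne_zero hsol.2.1
    simpa using this
  have hbar3 : MemLp (stBar T u) 3 μ := by
    have := memLp_stBar hm (by norm_num : (3 : ℕ) ≠ 0) hu3
    simpa using this
  have hbar32 : MemLp (stBar T u) (3 / 2) μ := by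
    have h : MemLp (uncurry u) 3 ((volume.restrict (Ioo 0 T)).prod volume) := by
      have h3 := hbar3
      rw [stBar, memLp_indicator_iff_restrict (measurableSet_Ioo.prod MeasurableSet.univ),
        ← Measure.restrict_prod_eq_prod_univ] at h3
      exact h3
    have h' : MemLp (uncurry u) (3 / 2) ((volume.restrict (Ioo 0 T)).prod volume) :=
      h.mono_exponent (ENNReal.div_le_of_le_mul (by norm_num))
    rw [stBar, memLp_indicator_iff_restrict (measurableSet_Ioo.prod MeasurableSet.univ),
      ← Measure.restrict_prod_eq_prod_univ]
    exact h'
  have hsmeas : ∀ j, AEStronglyMeasurable (fun q => stBar T u q j) μ := fun j => (hbar2.eval_piLp j).1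
  set Uc : d → ℝ × UnitAddTorus d → ℝ := fun j => (hsmeas j).mk _ with hUcdef
  have hUm : ∀ j, StronglyMeasurable (Uc j) := fun j => (hsmeas j).stronglyMeasurable_mk
  have hUc : ∀ j, Uc j =ᵐ[μ] fun q => stBar T u q j := fun j => (hsmeas j).ae_eq_mk.symm
  have hU1 : ∀ j, Integrable (Uc j) μ := fun j =>
    ((EuclideanSpace.proj (𝕜 := ℝ) j).integrable_comp hbar1).congr (hsmeas j).ae_eq_mk
  have hU3 : ∀ j, MemLp (Uc j) 3 μ := fun j => (hbar3.eval_piLp j).ae_eq (hsmeas j).ae_eq_mk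
  have hU32' : ∀ j, MemLp (Uc j) (3 / 2) μ := fun j => (hbar32.eval_piLp j).ae_eq (hsmeas j).ae_eq_mk
  have hU32 : ∀ j i, MemLp (fun q => Uc j q * Uc i q) (3 / 2) μ := fun j i => by
    haveI := FunctionSpaces.holderTriple_three_three
    exact (hU3 i).mul (hU3 j)
  have hpbar1 : Integrable (stBarScalar T p) μ := integrable_stBarScalar hsol.2.2.1 hsol.2.2.2.1
  have hpbar32 : MemLp (stBarScalar T p) (3 / 2) μ := memLp_stBarScalar hsol.2.2.1 hp
  -- the cut-off components `Ψⱼ = ψ Uⱼ`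
  set Ψ : d → ℝ × UnitAddTorus d → ℝ := fun j q => ψ q.1 q.2 * Uc j q with hΨdef
  have hΨm : ∀ j, StronglyMeasurable (Ψ j) := fun j =>
    (hψc.stronglyMeasurable.comp_measurable (measurable_fst.prodMk measurable_snd)).mul (hUm j)
  have hΨ1 : ∀ j, Integrable (Ψ j) μ := fun j => integrable_cutoff_mul (hU1 j) hψc hψb
  have hΨ3 : ∀ j, MemLp (Ψ j) 3 μ := fun j => by
    refine ⟨(hΨm j).aestronglyMeasurable, lt_of_le_of_lt (eLpNorm_le_mul_eLpNorm_of_ae_le_mul (g := Uc j) (c := Cψ)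
      (Eventually.of_forall fun q => ?_) 3) (ENNReal.mul_lt_top ENNReal.ofReal_lt_top (hU3 j).2)⟩
    simp only [hΨdef, norm_mul, Real.norm_eq_abs]
    exact mul_le_mul_of_nonneg_right (hψb _ _) (abs_nonneg _)
  ------------------------------------------------------------------ the test fields
  set φc : ℕ → d → ℝ → UnitAddTorus d → ℝ := fun n i t x => ∑ j, drTest (ρ n) (M i j) ψ (Uc j) t x with hφcdef
  have hφs : ∀ n i, ContDiff ℝ ∞ (FunctionSpaces.Torus.stLift (φc n i)) := fun n i =>
    contDiff_stLift_sum_drTest hU1 (hρs n) (hρc n) hM hψst hψb i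
  have hφzero : ∀ n t, (t ≤ a - δ₀ ∨ b + δ₀ ≤ t) → vecField (φc n) t = 0 := by
    intro n t ht
    funext x
    ext i
    simp only [vecField_apply, hφcdef]
    rw [sum_drTest_eq_zero_of_dist (M := M) (U := Uc) hδ₀pos hψab (hρsupp n) ht i x]
    rfl
  have htest : ∀ n, FunctionSpaces.Torus.IsSpaceTimeTestIoo T (vecField (φc n)) := fun n =>
    ⟨⟨by rw [stLift_vecField]; exact contDiff_piLp' (p := 2) fun j => hφs n j,
      b + δ₀, hδ₀b, fun t ht => hφzero n t (Or.inr ht)⟩,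
      a - δ₀, hδ₀a, fun t ht => hφzero n t (Or.inl ht)⟩
  have hweak : ∀ n, ∫ t in Ioo 0 T, ∫ x, (⟪u t x, FunctionSpaces.Torus.timeDeriv (vecField (φc n)) t x⟫ +
      ⟪u t x, FunctionSpaces.Torus.convect (u t) (vecField (φc n) t) x⟫ +
        ν * ⟪u t x, FunctionSpaces.Torus.laplacian (vecField (φc n) t) x⟫ +
        p t x * FunctionSpaces.Torus.divergence (vecField (φc n) t) x +
        ⟪(0 : ℝ → UnitAddTorus d → EuclideanSpace ℝ d) t x, vecField (φc n) t x⟫) = 0 := fun n =>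
    hsol.2.2.2.2.2 _ (htest n)
  ------------------------------------------------------------------ generic facts on the mollified pieces
  have hSc : ∀ n {F : ℝ × UnitAddTorus d → ℝ} (_ : Integrable F μ) {k : UnitAddTorus d → ℝ}
      (_ : FunctionSpaces.Torus.IsSmooth k), Continuous (uncurry (FunctionSpaces.Torus.stConv (ρ n) k F)) :=
    fun n F hF k hk => FunctionSpaces.Torus.continuous_uncurry_of_continuous_stLift
      (FunctionSpaces.Torus.contDiff_top_stLift_stConv hF (hρs n) (hρc n) hk).continuous
  have hS'c : ∀ n {F : ℝ × UnitAddTorus d → ℝ} (_ : Integrable F μ) {k : UnitAddTorus d → ℝ}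
      (_ : FunctionSpaces.Torus.IsSmooth k), Continuous (uncurry (FunctionSpaces.Torus.stConv (deriv (ρ n)) k F)) :=
    fun n F hF k hk => FunctionSpaces.Torus.continuous_uncurry_of_continuous_stLift
      (FunctionSpaces.Torus.contDiff_top_stLift_stConv hF (hρs n).deriv' (hρc n).deriv hk).continuous
  have hSb : ∀ n {F : ℝ × UnitAddTorus d → ℝ} (_ : Integrable F μ) {k : UnitAddTorus d → ℝ} (_ : Continuous k),
      ∃ C, ∀ t x, |FunctionSpaces.Torus.stConv (ρ n) k F t x| ≤ C :=
    fun n F hF k hk => exists_abs_stConv_le hF (hρcont n) (hρc n) hk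
  have hS'b : ∀ n {F : ℝ × UnitAddTorus d → ℝ} (_ : Integrable F μ) {k : UnitAddTorus d → ℝ} (_ : Continuous k),
      ∃ C, ∀ t x, |FunctionSpaces.Torus.stConv (deriv (ρ n)) k F t x| ≤ C :=
    fun n F hF k hk => exists_abs_stConv_le hF ((hρs n).continuous_deriv (by simp)) (hρc n).deriv hk
  have hMk : ∀ k i j, FunctionSpaces.Torus.IsSmooth (FunctionSpaces.Torus.partialDeriv k (M i j)) :=
    fun k i j => (hM i j).partialDeriv k
  have hMkk : ∀ k i j, FunctionSpaces.Torus.IsSmooth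
      (FunctionSpaces.Torus.partialDeriv k (FunctionSpaces.Torus.partialDeriv k (M i j))) :=
    fun k i j => (hMk k i j).partialDeriv k
  ------------------------------------------------------------------ derivative data of the test fields
  have hdt : ∀ n i t x, FunctionSpaces.Torus.timeDeriv (φc n i) t x =
      ∑ j, (FunctionSpaces.Torus.timeDeriv ψ t x * FunctionSpaces.Torus.stConv (ρ n) (M i j) (Uc j) t x +
        ψ t x * FunctionSpaces.Torus.stConv (deriv (ρ n)) (M i j) (Uc j) t x +
        FunctionSpaces.Torus.stConv (deriv (ρ n)) (M i j) (Ψ j) t x) := fun n i t x =>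
    timeDeriv_sum_drTest hU1 (hρs n) (hρc n) hM hψst hψb i t x
  have hdx : ∀ n i k t x, FunctionSpaces.Torus.partialDeriv k (φc n i t) x =
      ∑ j, (FunctionSpaces.Torus.partialDeriv k (ψ t) x * FunctionSpaces.Torus.stConv (ρ n) (M i j) (Uc j) t x +
        ψ t x * FunctionSpaces.Torus.stConv (ρ n) (FunctionSpaces.Torus.partialDeriv k (M i j)) (Uc j) t x +
        FunctionSpaces.Torus.stConv (ρ n) (FunctionSpaces.Torus.partialDeriv k (M i j)) (Ψ j) t x) :=
    fun n i k t x => partialDeriv_sum_drTest hU1 (hρs n) (hρc n) hM hψst hψb k i t x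
  have hdL : ∀ n i t x, FunctionSpaces.Torus.laplacian (φc n i t) x =
      ∑ j, (FunctionSpaces.Torus.laplacian (ψ t) x * FunctionSpaces.Torus.stConv (ρ n) (M i j) (Uc j) t x +
        2 * ∑ k, FunctionSpaces.Torus.partialDeriv k (ψ t) x *
          FunctionSpaces.Torus.stConv (ρ n) (FunctionSpaces.Torus.partialDeriv k (M i j)) (Uc j) t x +
        ψ t x * ∑ k, FunctionSpaces.Torus.stConv (ρ n)
          (FunctionSpaces.Torus.partialDeriv k (FunctionSpaces.Torus.partialDeriv k (M i j))) (Uc j) t x +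
        ∑ k, FunctionSpaces.Torus.stConv (ρ n)
          (FunctionSpaces.Torus.partialDeriv k (FunctionSpaces.Torus.partialDeriv k (M i j))) (Ψ j) t x) :=
    fun n i t x => laplacian_sum_drTest hU1 (hρs n) (hρc n) hM hψst hψb i t x
  have hdtc : ∀ n i, Continuous (uncurry (FunctionSpaces.Torus.timeDeriv (φc n i))) := fun n i => by
    have e : uncurry (FunctionSpaces.Torus.timeDeriv (φc n i)) = fun q =>
        ∑ j, (FunctionSpaces.Torus.timeDeriv ψ q.1 q.2 * FunctionSpaces.Torus.stConv (ρ n) (M i j) (Uc j) q.1 q.2 +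
          ψ q.1 q.2 * FunctionSpaces.Torus.stConv (deriv (ρ n)) (M i j) (Uc j) q.1 q.2 +
          FunctionSpaces.Torus.stConv (deriv (ρ n)) (M i j) (Ψ j) q.1 q.2) := by
      funext q; exact hdt n i q.1 q.2
    rw [e]
    exact continuous_finsetSum _ fun j _ =>
      ((hψtc.mul (hSc n (hU1 j) (hM i j))).add (hψc.mul (hS'c n (hU1 j) (hM i j)))).add (hS'c n (hΨ1 j) (hM i j))
  have hdxc : ∀ n i k, Continuous (uncurry fun t x => FunctionSpaces.Torus.partialDeriv k (φc n i t) x) := fun n i k => by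
    have e : (uncurry fun t x => FunctionSpaces.Torus.partialDeriv k (φc n i t) x) = fun q =>
        ∑ j, (FunctionSpaces.Torus.partialDeriv k (ψ q.1) q.2 * FunctionSpaces.Torus.stConv (ρ n) (M i j) (Uc j) q.1 q.2 +
          ψ q.1 q.2 * FunctionSpaces.Torus.stConv (ρ n) (FunctionSpaces.Torus.partialDeriv k (M i j)) (Uc j) q.1 q.2 +
          FunctionSpaces.Torus.stConv (ρ n) (FunctionSpaces.Torus.partialDeriv k (M i j)) (Ψ j) q.1 q.2) := by
      funext q; exact hdx n i k q.1 q.2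
    rw [e]
    exact continuous_finsetSum _ fun j _ =>
      (((hψic k).mul (hSc n (hU1 j) (hM i j))).add (hψc.mul (hSc n (hU1 j) (hMk k i j)))).add
        (hSc n (hΨ1 j) (hMk k i j))
  have hdLc : ∀ n i, Continuous (uncurry fun t x => FunctionSpaces.Torus.laplacian (φc n i t) x) := fun n i => by
    have e : (uncurry fun t x => FunctionSpaces.Torus.laplacian (φc n i t) x) = fun q =>
        ∑ j, (FunctionSpaces.Torus.laplacian (ψ q.1) q.2 * FunctionSpaces.Torus.stConv (ρ n) (M i j) (Uc j) q.1 q.2 +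
          2 * ∑ k, FunctionSpaces.Torus.partialDeriv k (ψ q.1) q.2 *
            FunctionSpaces.Torus.stConv (ρ n) (FunctionSpaces.Torus.partialDeriv k (M i j)) (Uc j) q.1 q.2 +
          ψ q.1 q.2 * ∑ k, FunctionSpaces.Torus.stConv (ρ n)
            (FunctionSpaces.Torus.partialDeriv k (FunctionSpaces.Torus.partialDeriv k (M i j))) (Uc j) q.1 q.2 +
          ∑ k, FunctionSpaces.Torus.stConv (ρ n)
            (FunctionSpaces.Torus.partialDeriv k (FunctionSpaces.Torus.partialDeriv k (M i j))) (Ψ j) q.1 q.2) := by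
      funext q; exact hdL n i q.1 q.2
    rw [e]
    refine continuous_finsetSum _ fun j _ => ?_
    refine (((hψLc.mul (hSc n (hU1 j) (hM i j))).add (continuous_const.mul
      (continuous_finsetSum _ fun k _ => (hψic k).mul (hSc n (hU1 j) (hMk k i j))))).add
      (hψc.mul (continuous_finsetSum _ fun k _ => hSc n (hU1 j) (hMkk k i j)))).add
      (continuous_finsetSum _ fun k _ => hSc n (hΨ1 j) (hMkk k i j))
  have hdtb : ∀ n i, ∃ C, ∀ t x, |FunctionSpaces.Torus.timeDeriv (φc n i) t x| ≤ C := fun n i => by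
    have hb : ∀ j, ∃ C, ∀ t x,
        |FunctionSpaces.Torus.timeDeriv ψ t x * FunctionSpaces.Torus.stConv (ρ n) (M i j) (Uc j) t x +
          ψ t x * FunctionSpaces.Torus.stConv (deriv (ρ n)) (M i j) (Uc j) t x +
          FunctionSpaces.Torus.stConv (deriv (ρ n)) (M i j) (Ψ j) t x| ≤ C := fun j => by
      obtain ⟨M₀, hM₀⟩ := hSb n (hU1 j) (hMc i j)
      obtain ⟨M₁, hM₁⟩ := hS'b n (hU1 j) (hMc i j)
      obtain ⟨M₂, hM₂⟩ := hS'b n (hΨ1 j) (hMc i j)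
      refine ⟨Cψt * M₀ + Cψ * M₁ + M₂, fun t x => ?_⟩
      have h1 : |FunctionSpaces.Torus.timeDeriv ψ t x * FunctionSpaces.Torus.stConv (ρ n) (M i j) (Uc j) t x| ≤ Cψt * M₀ := by
        rw [abs_mul]; exact mul_le_mul (hψtb _ _) (hM₀ _ _) (abs_nonneg _) ((abs_nonneg _).trans (hψtb 0 0))
      have h2 : |ψ t x * FunctionSpaces.Torus.stConv (deriv (ρ n)) (M i j) (Uc j) t x| ≤ Cψ * M₁ := by
        rw [abs_mul]; exact mul_le_mul (hψb _ _) (hM₁ _ _) (abs_nonneg _) ((abs_nonneg _).trans (hψb 0 0))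
      exact ((abs_add_le _ _).trans (add_le_add ((abs_add_le _ _).trans (add_le_add h1 h2)) (hM₂ _ _)))
    choose C hC using hb
    refine ⟨∑ j, C j, fun t x => ?_⟩
    rw [hdt]
    exact (Finset.abs_sum_le_sum_abs _ _).trans (Finset.sum_le_sum fun j _ => hC j t x)
  have hdxb : ∀ n i k, ∃ C, ∀ t x, |FunctionSpaces.Torus.partialDeriv k (φc n i t) x| ≤ C := fun n i k => by
    have hb : ∀ j, ∃ C, ∀ t x,
        |FunctionSpaces.Torus.partialDeriv k (ψ t) x * FunctionSpaces.Torus.stConv (ρ n) (M i j) (Uc j) t x +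
          ψ t x * FunctionSpaces.Torus.stConv (ρ n) (FunctionSpaces.Torus.partialDeriv k (M i j)) (Uc j) t x +
          FunctionSpaces.Torus.stConv (ρ n) (FunctionSpaces.Torus.partialDeriv k (M i j)) (Ψ j) t x| ≤ C := fun j => by
      obtain ⟨M₀, hM₀⟩ := hSb n (hU1 j) (hMc i j)
      obtain ⟨M₁, hM₁⟩ := hSb n (hU1 j) (hMk k i j).continuous
      obtain ⟨M₂, hM₂⟩ := hSb n (hΨ1 j) (hMk k i j).continuous
      refine ⟨Cψi k * M₀ + Cψ * M₁ + M₂, fun t x => ?_⟩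
      have h1 : |FunctionSpaces.Torus.partialDeriv k (ψ t) x * FunctionSpaces.Torus.stConv (ρ n) (M i j) (Uc j) t x| ≤
          Cψi k * M₀ := by
        rw [abs_mul]; exact mul_le_mul (hψib k _ _) (hM₀ _ _) (abs_nonneg _) (hCψi0 k)
      have h2 : |ψ t x * FunctionSpaces.Torus.stConv (ρ n) (FunctionSpaces.Torus.partialDeriv k (M i j)) (Uc j) t x| ≤
          Cψ * M₁ := by
        rw [abs_mul]; exact mul_le_mul (hψb _ _) (hM₁ _ _) (abs_nonneg _) ((abs_nonneg _).trans (hψb 0 0))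
      exact ((abs_add_le _ _).trans (add_le_add ((abs_add_le _ _).trans (add_le_add h1 h2)) (hM₂ _ _)))
    choose C hC using hb
    refine ⟨∑ j, C j, fun t x => ?_⟩
    rw [hdx]
    exact (Finset.abs_sum_le_sum_abs _ _).trans (Finset.sum_le_sum fun j _ => hC j t x)
  have hdLb : ∀ n i, ∃ C, ∀ t x, |FunctionSpaces.Torus.laplacian (φc n i t) x| ≤ C := fun n i => by
    -- compact support in time: the field vanishes for `t ∉ [a - δ₀, b + δ₀]`
    have hcs : HasCompactSupport (uncurry fun t x => FunctionSpaces.Torus.laplacian (φc n i t) x) := by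
      refine HasCompactSupport.intro' ((isCompact_Icc (a := a - δ₀) (b := b + δ₀)).prod isCompact_univ)
        ((isClosed_Icc.prod isClosed_univ)) fun q hq => ?_
      have ht : q.1 ≤ a - δ₀ ∨ b + δ₀ ≤ q.1 := by
        by_contra h
        rw [not_or, not_le, not_le] at h
        exact hq ⟨⟨h.1.le, h.2.le⟩, mem_univ _⟩
      have hz : φc n i q.1 = fun _ => 0 := by
        funext x
        have := congrArg (fun f => f x i) (hφzero n q.1 ht)
        simpa [vecField] using this
      show FunctionSpaces.Torus.laplacian (φc n i q.1) q.2 = 0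
      rw [hz]
      exact laplacian_zero_fun q.2
    obtain ⟨C, hC⟩ := (hdLc n i).bounded_above_of_compact_support hcs
    exact ⟨C, fun t x => by simpa [Real.norm_eq_abs] using hC (t, x)⟩
  ------------------------------------------------------------------ (Eₙ)
  have hEn : ∀ n, ∑ i, ∫ q, Uc i q * FunctionSpaces.Torus.timeDeriv (φc n i) q.1 q.2 ∂μ +
      ∑ i, ∑ k, ∫ q, Uc i q * Uc k q * FunctionSpaces.Torus.partialDeriv k (φc n i q.1) q.2 ∂μ +
      ν * ∑ i, ∫ q, Uc i q * FunctionSpaces.Torus.laplacian (φc n i q.1) q.2 ∂μ +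
      ∫ q, stBarScalar T p q * ∑ i, FunctionSpaces.Torus.partialDeriv i (φc n i q.1) q.2 ∂μ = 0 := fun n =>
    weakForm_rewrite_pressure (hweak n) (hφs n) (hdtc n) (hdxc n) (hdLc n) (hdtb n) (hdxb n) (hdLb n)
      hbar1 hbar2 hpbar1 hUc
  ------------------------------------------------------------------ `L³` limits of the mollified pieces
  have h13 : (1 : ℝ≥0∞) ≤ 3 := by norm_num
  have h3t : (3 : ℝ≥0∞) ≠ ⊤ := ENNReal.ofNat_ne_top
  -- generic: `stConv (ρ n) k F → sliceConv F k` in `L³`, with limit in `L³`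
  have hconv : ∀ {F : ℝ × UnitAddTorus d → ℝ} (_ : StronglyMeasurable F) (_ : Integrable F μ) (_ : MemLp F 3 μ)
      {k : UnitAddTorus d → ℝ} (_ : Continuous k),
      Tendsto (fun n => eLpNorm (fun q : ℝ × UnitAddTorus d =>
        FunctionSpaces.Torus.stConv (ρ n) k F q.1 q.2 - sliceConv F k q.1 q.2) 3 μ) atTop (𝓝 0) :=
    fun hFm hF1 hF3 k hk => tendsto_eLpNorm_stConv_sub_sliceConv hφ0 hFm hF1 h13 h3t hF3.2 hk
  have hmem : ∀ {F : ℝ × UnitAddTorus d → ℝ} (_ : StronglyMeasurable F) (_ : MemLp F 3 μ)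
      {k : UnitAddTorus d → ℝ} (_ : Continuous k), MemLp (fun q : ℝ × UnitAddTorus d => sliceConv F k q.1 q.2) 3 μ :=
    fun hFm hF3 k hk => ⟨(stronglyMeasurable_uncurry_sliceConv hFm hk).aestronglyMeasurable,
      (eLpNorm_uncurry_sliceConv_le hFm hk h13 h3t).trans_lt (ENNReal.mul_lt_top hk.integrable_unitAddTorus.2 hF3.2)⟩
  have hmem_mul : ∀ {c : ℝ × UnitAddTorus d → ℝ} {C : ℝ} (_ : Continuous c) (_ : ∀ q, |c q| ≤ C)
      {g : ℝ × UnitAddTorus d → ℝ} (_ : MemLp g 3 μ), MemLp (fun q => c q * g q) 3 μ :=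
    fun hcc hcb g hg => hg.of_le_mul (hcc.aestronglyMeasurable.mul hg.1) (Eventually.of_forall fun q => by
      rw [norm_mul, Real.norm_eq_abs]; exact mul_le_mul_of_nonneg_right (hcb q) (norm_nonneg _))
  have hSm : ∀ n {F : ℝ × UnitAddTorus d → ℝ} (_ : Integrable F μ) {k : UnitAddTorus d → ℝ}
      (_ : FunctionSpaces.Torus.IsSmooth k),
      AEStronglyMeasurable (fun q : ℝ × UnitAddTorus d => FunctionSpaces.Torus.stConv (ρ n) k F q.1 q.2) μ :=
    fun n F hF k hk => (hSc n hF hk).aestronglyMeasurable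
  -- the coefficient fields on `ℝ × T^d`
  have hcψ : ∀ q : ℝ × UnitAddTorus d, |ψ q.1 q.2| ≤ Cψ := fun q => hψb q.1 q.2
  have hcψt : ∀ q : ℝ × UnitAddTorus d, |FunctionSpaces.Torus.timeDeriv ψ q.1 q.2| ≤ Cψt := fun q => hψtb q.1 q.2
  have hcψi : ∀ i (q : ℝ × UnitAddTorus d), |FunctionSpaces.Torus.partialDeriv i (ψ q.1) q.2| ≤ Cψi i := fun i q => hψib i q.1 q.2
  have hcψL : ∀ q : ℝ × UnitAddTorus d, |FunctionSpaces.Torus.laplacian (ψ q.1) q.2| ≤ CψL := fun q => hψLb q.1 q.2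
  have hcψc : Continuous fun q : ℝ × UnitAddTorus d => ψ q.1 q.2 := hψc
  have hcψtc : Continuous fun q : ℝ × UnitAddTorus d => FunctionSpaces.Torus.timeDeriv ψ q.1 q.2 := hψtc
  have hcψic : ∀ i, Continuous fun q : ℝ × UnitAddTorus d => FunctionSpaces.Torus.partialDeriv i (ψ q.1) q.2 := hψic
  have hcψLc : Continuous fun q : ℝ × UnitAddTorus d => FunctionSpaces.Torus.laplacian (ψ q.1) q.2 := hψLc
  ---------------------------------------------------------------- Term 1 (time)
  set g1 : ℕ → d → d → ℝ × UnitAddTorus d → ℝ := fun n i j q =>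
    FunctionSpaces.Torus.timeDeriv ψ q.1 q.2 * FunctionSpaces.Torus.stConv (ρ n) (M i j) (Uc j) q.1 q.2 with hg1
  set g1i : d → d → ℝ × UnitAddTorus d → ℝ := fun i j q =>
    FunctionSpaces.Torus.timeDeriv ψ q.1 q.2 * sliceConv (Uc j) (M i j) q.1 q.2 with hg1i
  have hT1form : ∀ n, ∑ i, ∫ q, Uc i q * FunctionSpaces.Torus.timeDeriv (φc n i) q.1 q.2 ∂μ =
      ∑ i, ∑ j, ∫ q, Uc i q * g1 n i j q ∂μ := fun n =>
    sum_integral_mul_timeDeriv_sum_drTest hU1 (hρs n) (hρc n) (hρeven n) hM hMev hMsymm hψst hψb hψtc hψtb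
  have hT1lim : Tendsto (fun n => ∑ i, ∫ q, Uc i q * FunctionSpaces.Torus.timeDeriv (φc n i) q.1 q.2 ∂μ) atTop
      (𝓝 (∑ i, ∑ j, ∫ q, Uc i q * g1i i j q ∂μ)) := by
    simp_rw [hT1form]
    refine tendsto_finsetSum _ fun i _ => tendsto_finsetSum _ fun j _ => ?_
    refine tendsto_integral_mul_of_tendsto_eLpNorm_three (hU32' i)
      (fun n => hcψtc.aestronglyMeasurable.mul (hSm n (hU1 j) (hM i j)))
      (hmem_mul hcψtc hcψt (hmem (hUm j) (hU3 j) (hMc i j))) ?_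
    exact tendsto_eLpNorm_mul_sub_mul hcψt (hconv (hUm j) (hU1 j) (hU3 j) (hMc i j))
  ---------------------------------------------------------------- Term 2 (convective)
  set g2 : ℕ → d → d → d → ℝ × UnitAddTorus d → ℝ := fun n i k j q =>
    FunctionSpaces.Torus.partialDeriv k (ψ q.1) q.2 * FunctionSpaces.Torus.stConv (ρ n) (M i j) (Uc j) q.1 q.2 +
      ψ q.1 q.2 * FunctionSpaces.Torus.stConv (ρ n) (FunctionSpaces.Torus.partialDeriv k (M i j)) (Uc j) q.1 q.2 +
      FunctionSpaces.Torus.stConv (ρ n) (FunctionSpaces.Torus.partialDeriv k (M i j)) (Ψ j) q.1 q.2 with hg2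
  set g2i : d → d → d → ℝ × UnitAddTorus d → ℝ := fun i k j q =>
    FunctionSpaces.Torus.partialDeriv k (ψ q.1) q.2 * sliceConv (Uc j) (M i j) q.1 q.2 +
      ψ q.1 q.2 * sliceConv (Uc j) (FunctionSpaces.Torus.partialDeriv k (M i j)) q.1 q.2 +
      sliceConv (Ψ j) (FunctionSpaces.Torus.partialDeriv k (M i j)) q.1 q.2 with hg2i
  have hg2m : ∀ n i k j, AEStronglyMeasurable (g2 n i k j) μ := fun n i k j =>
    (((hcψic k).aestronglyMeasurable.mul (hSm n (hU1 j) (hM i j))).add (hcψc.aestronglyMeasurable.mul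
      (hSm n (hU1 j) (hMk k i j)))).add (hSm n (hΨ1 j) (hMk k i j))
  have hg2im : ∀ i k j, MemLp (g2i i k j) 3 μ := fun i k j =>
    ((hmem_mul (hcψic k) (hcψi k) (hmem (hUm j) (hU3 j) (hMc i j))).add
      (hmem_mul hcψc hcψ (hmem (hUm j) (hU3 j) (hMk k i j).continuous))).add
      (hmem (hΨm j) (hΨ3 j) (hMk k i j).continuous)
  have hg2conv : ∀ i k j, Tendsto (fun n => eLpNorm (fun q => g2 n i k j q - g2i i k j q) 3 μ) atTop (𝓝 0) := by
    intro i k j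
    refine tendsto_eLpNorm_add_sub_add h13 (Eventually.of_forall fun n => ?_) (Eventually.of_forall fun n => ?_)
      (tendsto_eLpNorm_add_sub_add h13 (Eventually.of_forall fun n => ?_) (Eventually.of_forall fun n => ?_)
        (tendsto_eLpNorm_mul_sub_mul (hcψi k) (hconv (hUm j) (hU1 j) (hU3 j) (hMc i j)))
        (tendsto_eLpNorm_mul_sub_mul hcψ (hconv (hUm j) (hU1 j) (hU3 j) (hMk k i j).continuous)))
      (hconv (hΨm j) (hΨ1 j) (hΨ3 j) (hMk k i j).continuous)
    · exact (((hcψic k).aestronglyMeasurable.mul (hSm n (hU1 j) (hM i j))).add (hcψc.aestronglyMeasurable.mul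
        (hSm n (hU1 j) (hMk k i j)))).sub (((hcψic k).aestronglyMeasurable.mul (hmem (hUm j) (hU3 j) (hMc i j)).1).add
        (hcψc.aestronglyMeasurable.mul (hmem (hUm j) (hU3 j) (hMk k i j).continuous).1))
    · exact (hSm n (hΨ1 j) (hMk k i j)).sub (hmem (hΨm j) (hΨ3 j) (hMk k i j).continuous).1
    · exact ((hcψic k).aestronglyMeasurable.mul (hSm n (hU1 j) (hM i j))).sub
        ((hcψic k).aestronglyMeasurable.mul (hmem (hUm j) (hU3 j) (hMc i j)).1)
    · exact (hcψc.aestronglyMeasurable.mul (hSm n (hU1 j) (hMk k i j))).sub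
        (hcψc.aestronglyMeasurable.mul (hmem (hUm j) (hU3 j) (hMk k i j).continuous).1)
  -- summed over the kernel index `j`
  have hG2m : ∀ n i k, AEStronglyMeasurable (fun q => ∑ j, g2 n i k j q) μ := fun n i k =>
    Finset.aestronglyMeasurable_fun_sum _ fun j _ => hg2m n i k j
  have hG2im : ∀ i k, MemLp (fun q => ∑ j, g2i i k j q) 3 μ := fun i k =>
    memLp_finsetSum Finset.univ fun j _ => hg2im i k j
  have hG2conv : ∀ i k, Tendsto (fun n => eLpNorm (fun q => ∑ j, g2 n i k j q - ∑ j, g2i i k j q) 3 μ) atTop (𝓝 0) :=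
    fun i k => tendsto_eLpNorm_finset_sum_sub (f := fun n j q => g2 n i k j q) (f₀ := fun j q => g2i i k j q)
      Finset.univ h13 (fun j _ => Eventually.of_forall fun n => (hg2m n i k j).sub (hg2im i k j).1)
      (fun j _ => hg2conv i k j)
  have hT2lim : Tendsto (fun n => ∑ i, ∑ k, ∫ q, Uc i q * Uc k q * FunctionSpaces.Torus.partialDeriv k (φc n i q.1) q.2 ∂μ)
      atTop (𝓝 (∑ i, ∑ k, ∫ q, Uc i q * Uc k q * (∑ j, g2i i k j q) ∂μ)) := by
    refine tendsto_finsetSum _ fun i _ => tendsto_finsetSum _ fun k _ => ?_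
    have e : ∀ n, (fun q => Uc i q * Uc k q * FunctionSpaces.Torus.partialDeriv k (φc n i q.1) q.2) =
        fun q => Uc i q * Uc k q * (∑ j, g2 n i k j q) := fun n => by
      funext q; rw [hdx n i k q.1 q.2]
    simp_rw [e]
    exact tendsto_integral_mul_of_tendsto_eLpNorm_three (f := fun q => Uc i q * Uc k q) (hU32 i k) (hG2m · i k)
      (hG2im i k) (hG2conv i k)
  ---------------------------------------------------------------- Term 3 (viscous)
  set g3 : ℕ → d → d → ℝ × UnitAddTorus d → ℝ := fun n i j q =>
    FunctionSpaces.Torus.laplacian (ψ q.1) q.2 * FunctionSpaces.Torus.stConv (ρ n) (M i j) (Uc j) q.1 q.2 +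
      2 * ∑ k, FunctionSpaces.Torus.partialDeriv k (ψ q.1) q.2 *
        FunctionSpaces.Torus.stConv (ρ n) (FunctionSpaces.Torus.partialDeriv k (M i j)) (Uc j) q.1 q.2 +
      ψ q.1 q.2 * ∑ k, FunctionSpaces.Torus.stConv (ρ n)
        (FunctionSpaces.Torus.partialDeriv k (FunctionSpaces.Torus.partialDeriv k (M i j))) (Uc j) q.1 q.2 +
      ∑ k, FunctionSpaces.Torus.stConv (ρ n) (FunctionSpaces.Torus.partialDeriv k (FunctionSpaces.Torus.partialDeriv k (M i j)))
        (Ψ j) q.1 q.2 with hg3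
  set g3i : d → d → ℝ × UnitAddTorus d → ℝ := fun i j q =>
    FunctionSpaces.Torus.laplacian (ψ q.1) q.2 * sliceConv (Uc j) (M i j) q.1 q.2 +
      2 * ∑ k, FunctionSpaces.Torus.partialDeriv k (ψ q.1) q.2 *
        sliceConv (Uc j) (FunctionSpaces.Torus.partialDeriv k (M i j)) q.1 q.2 +
      ψ q.1 q.2 * ∑ k, sliceConv (Uc j) (FunctionSpaces.Torus.partialDeriv k (FunctionSpaces.Torus.partialDeriv k (M i j))) q.1 q.2 +
      ∑ k, sliceConv (Ψ j) (FunctionSpaces.Torus.partialDeriv k (FunctionSpaces.Torus.partialDeriv k (M i j))) q.1 q.2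
    with hg3i
  -- measurability of the pieces
  have m3a : ∀ n i j, AEStronglyMeasurable (fun q : ℝ × UnitAddTorus d =>
      FunctionSpaces.Torus.laplacian (ψ q.1) q.2 * FunctionSpaces.Torus.stConv (ρ n) (M i j) (Uc j) q.1 q.2) μ :=
    fun n i j => hcψLc.aestronglyMeasurable.mul (hSm n (hU1 j) (hM i j))
  have m3ai : ∀ i j, AEStronglyMeasurable (fun q : ℝ × UnitAddTorus d =>
      FunctionSpaces.Torus.laplacian (ψ q.1) q.2 * sliceConv (Uc j) (M i j) q.1 q.2) μ :=
    fun i j => hcψLc.aestronglyMeasurable.mul (hmem (hUm j) (hU3 j) (hMc i j)).1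
  have m3b1 : ∀ n i j k, AEStronglyMeasurable (fun q : ℝ × UnitAddTorus d => FunctionSpaces.Torus.partialDeriv k (ψ q.1) q.2 *
      FunctionSpaces.Torus.stConv (ρ n) (FunctionSpaces.Torus.partialDeriv k (M i j)) (Uc j) q.1 q.2) μ :=
    fun n i j k => (hcψic k).aestronglyMeasurable.mul (hSm n (hU1 j) (hMk k i j))
  have m3b1i : ∀ i j k, AEStronglyMeasurable (fun q : ℝ × UnitAddTorus d => FunctionSpaces.Torus.partialDeriv k (ψ q.1) q.2 *
      sliceConv (Uc j) (FunctionSpaces.Torus.partialDeriv k (M i j)) q.1 q.2) μ :=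
    fun i j k => (hcψic k).aestronglyMeasurable.mul (hmem (hUm j) (hU3 j) (hMk k i j).continuous).1
  have m3c1 : ∀ n i j k, AEStronglyMeasurable (fun q : ℝ × UnitAddTorus d => FunctionSpaces.Torus.stConv (ρ n)
      (FunctionSpaces.Torus.partialDeriv k (FunctionSpaces.Torus.partialDeriv k (M i j))) (Uc j) q.1 q.2) μ :=
    fun n i j k => hSm n (hU1 j) (hMkk k i j)
  have m3c1i : ∀ i j k, AEStronglyMeasurable (fun q : ℝ × UnitAddTorus d =>
      sliceConv (Uc j) (FunctionSpaces.Torus.partialDeriv k (FunctionSpaces.Torus.partialDeriv k (M i j))) q.1 q.2) μ :=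
    fun i j k => (hmem (hUm j) (hU3 j) (hMkk k i j).continuous).1
  have m3d1 : ∀ n i j k, AEStronglyMeasurable (fun q : ℝ × UnitAddTorus d => FunctionSpaces.Torus.stConv (ρ n)
      (FunctionSpaces.Torus.partialDeriv k (FunctionSpaces.Torus.partialDeriv k (M i j))) (Ψ j) q.1 q.2) μ :=
    fun n i j k => hSm n (hΨ1 j) (hMkk k i j)
  have m3d1i : ∀ i j k, AEStronglyMeasurable (fun q : ℝ × UnitAddTorus d =>
      sliceConv (Ψ j) (FunctionSpaces.Torus.partialDeriv k (FunctionSpaces.Torus.partialDeriv k (M i j))) q.1 q.2) μ :=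
    fun i j k => (hmem (hΨm j) (hΨ3 j) (hMkk k i j).continuous).1
  have h2c : ∀ q : ℝ × UnitAddTorus d, |(fun _ : ℝ × UnitAddTorus d => (2 : ℝ)) q| ≤ 2 := fun q => by norm_num
  -- convergence of the four summands
  have hc3a : ∀ i j, Tendsto (fun n => eLpNorm (fun q : ℝ × UnitAddTorus d =>
      FunctionSpaces.Torus.laplacian (ψ q.1) q.2 * FunctionSpaces.Torus.stConv (ρ n) (M i j) (Uc j) q.1 q.2 -
        FunctionSpaces.Torus.laplacian (ψ q.1) q.2 * sliceConv (Uc j) (M i j) q.1 q.2) 3 μ) atTop (𝓝 0) := fun i j =>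
    tendsto_eLpNorm_mul_sub_mul hcψL (hconv (hUm j) (hU1 j) (hU3 j) (hMc i j))
  have hc3b : ∀ i j, Tendsto (fun n => eLpNorm (fun q : ℝ × UnitAddTorus d =>
      (fun _ : ℝ × UnitAddTorus d => (2 : ℝ)) q * ∑ k, FunctionSpaces.Torus.partialDeriv k (ψ q.1) q.2 *
          FunctionSpaces.Torus.stConv (ρ n) (FunctionSpaces.Torus.partialDeriv k (M i j)) (Uc j) q.1 q.2 -
        (fun _ : ℝ × UnitAddTorus d => (2 : ℝ)) q * ∑ k, FunctionSpaces.Torus.partialDeriv k (ψ q.1) q.2 *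
          sliceConv (Uc j) (FunctionSpaces.Torus.partialDeriv k (M i j)) q.1 q.2) 3 μ) atTop (𝓝 0) := fun i j =>
    tendsto_eLpNorm_mul_sub_mul h2c (tendsto_eLpNorm_finset_sum_sub Finset.univ h13
      (fun k _ => Eventually.of_forall fun n => (m3b1 n i j k).sub (m3b1i i j k))
      (fun k _ => tendsto_eLpNorm_mul_sub_mul (hcψi k) (hconv (hUm j) (hU1 j) (hU3 j) (hMk k i j).continuous)))
  have hc3c : ∀ i j, Tendsto (fun n => eLpNorm (fun q : ℝ × UnitAddTorus d =>
      ψ q.1 q.2 * ∑ k, FunctionSpaces.Torus.stConv (ρ n)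
          (FunctionSpaces.Torus.partialDeriv k (FunctionSpaces.Torus.partialDeriv k (M i j))) (Uc j) q.1 q.2 -
        ψ q.1 q.2 * ∑ k, sliceConv (Uc j) (FunctionSpaces.Torus.partialDeriv k (FunctionSpaces.Torus.partialDeriv k (M i j))) q.1 q.2)
        3 μ) atTop (𝓝 0) := fun i j =>
    tendsto_eLpNorm_mul_sub_mul hcψ (tendsto_eLpNorm_finset_sum_sub Finset.univ h13
      (fun k _ => Eventually.of_forall fun n => (m3c1 n i j k).sub (m3c1i i j k))
      (fun k _ => hconv (hUm j) (hU1 j) (hU3 j) (hMkk k i j).continuous))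
  have hc3d : ∀ i j, Tendsto (fun n => eLpNorm (fun q : ℝ × UnitAddTorus d =>
      ∑ k, FunctionSpaces.Torus.stConv (ρ n) (FunctionSpaces.Torus.partialDeriv k (FunctionSpaces.Torus.partialDeriv k (M i j)))
          (Ψ j) q.1 q.2 -
        ∑ k, sliceConv (Ψ j) (FunctionSpaces.Torus.partialDeriv k (FunctionSpaces.Torus.partialDeriv k (M i j))) q.1 q.2) 3 μ)
        atTop (𝓝 0) := fun i j =>
    tendsto_eLpNorm_finset_sum_sub Finset.univ h13 (fun k _ => Eventually.of_forall fun n => (m3d1 n i j k).sub (m3d1i i j k))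
      (fun k _ => hconv (hΨm j) (hΨ1 j) (hΨ3 j) (hMkk k i j).continuous)
  have hg3m : ∀ n i j, AEStronglyMeasurable (g3 n i j) μ := fun n i j =>
    (((m3a n i j).add (aestronglyMeasurable_const.mul (Finset.aestronglyMeasurable_fun_sum _ fun k _ => m3b1 n i j k))).add
      (hcψc.aestronglyMeasurable.mul (Finset.aestronglyMeasurable_fun_sum _ fun k _ => m3c1 n i j k))).add
      (Finset.aestronglyMeasurable_fun_sum _ fun k _ => m3d1 n i j k)
  have hg3im : ∀ i j, MemLp (g3i i j) 3 μ := fun i j =>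
    (((hmem_mul hcψLc hcψL (hmem (hUm j) (hU3 j) (hMc i j))).add
      ((memLp_finsetSum Finset.univ fun k _ => hmem_mul (hcψic k) (hcψi k)
        (hmem (hUm j) (hU3 j) (hMk k i j).continuous)).const_mul 2)).add
      (hmem_mul hcψc hcψ (memLp_finsetSum Finset.univ fun k _ => hmem (hUm j) (hU3 j) (hMkk k i j).continuous))).add
      (memLp_finsetSum Finset.univ fun k _ => hmem (hΨm j) (hΨ3 j) (hMkk k i j).continuous)
  have hg3conv : ∀ i j, Tendsto (fun n => eLpNorm (fun q => g3 n i j q - g3i i j q) 3 μ) atTop (𝓝 0) := by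
    intro i j
    have hA := tendsto_eLpNorm_add_sub_add h13
      (Eventually.of_forall fun n => (m3a n i j).sub (m3ai i j))
      (Eventually.of_forall fun n => (aestronglyMeasurable_const.mul (Finset.aestronglyMeasurable_fun_sum _ fun k _ => m3b1 n i j k)).sub
        (aestronglyMeasurable_const.mul (Finset.aestronglyMeasurable_fun_sum _ fun k _ => m3b1i i j k)))
      (hc3a i j) (hc3b i j)
    have hB := tendsto_eLpNorm_add_sub_add h13
      (Eventually.of_forall fun n => ((m3a n i j).add (aestronglyMeasurable_const.mul
        (Finset.aestronglyMeasurable_fun_sum _ fun k _ => m3b1 n i j k))).sub ((m3ai i j).add (aestronglyMeasurable_const.mul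
        (Finset.aestronglyMeasurable_fun_sum _ fun k _ => m3b1i i j k))))
      (Eventually.of_forall fun n => (hcψc.aestronglyMeasurable.mul (Finset.aestronglyMeasurable_fun_sum _ fun k _ => m3c1 n i j k)).sub
        (hcψc.aestronglyMeasurable.mul (Finset.aestronglyMeasurable_fun_sum _ fun k _ => m3c1i i j k)))
      hA (hc3c i j)
    have hC := tendsto_eLpNorm_add_sub_add h13
      (Eventually.of_forall fun n => (((m3a n i j).add (aestronglyMeasurable_const.mul
        (Finset.aestronglyMeasurable_fun_sum _ fun k _ => m3b1 n i j k))).add (hcψc.aestronglyMeasurable.mul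
        (Finset.aestronglyMeasurable_fun_sum _ fun k _ => m3c1 n i j k))).sub (((m3ai i j).add (aestronglyMeasurable_const.mul
        (Finset.aestronglyMeasurable_fun_sum _ fun k _ => m3b1i i j k))).add (hcψc.aestronglyMeasurable.mul
        (Finset.aestronglyMeasurable_fun_sum _ fun k _ => m3c1i i j k))))
      (Eventually.of_forall fun n => (Finset.aestronglyMeasurable_fun_sum _ fun k _ => m3d1 n i j k).sub
        (Finset.aestronglyMeasurable_fun_sum _ fun k _ => m3d1i i j k))
      hB (hc3d i j)
    exact hC
  -- summed over the kernel index `j`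
  have hG3m : ∀ n i, AEStronglyMeasurable (fun q => ∑ j, g3 n i j q) μ := fun n i =>
    Finset.aestronglyMeasurable_fun_sum _ fun j _ => hg3m n i j
  have hG3im : ∀ i, MemLp (fun q => ∑ j, g3i i j q) 3 μ := fun i =>
    memLp_finsetSum Finset.univ fun j _ => hg3im i j
  have hG3conv : ∀ i, Tendsto (fun n => eLpNorm (fun q => ∑ j, g3 n i j q - ∑ j, g3i i j q) 3 μ) atTop (𝓝 0) :=
    fun i => tendsto_eLpNorm_finset_sum_sub (f := fun n j q => g3 n i j q) (f₀ := fun j q => g3i i j q)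
      Finset.univ h13 (fun j _ => Eventually.of_forall fun n => (hg3m n i j).sub (hg3im i j).1)
      (fun j _ => hg3conv i j)
  have hT3lim : Tendsto (fun n => ∑ i, ∫ q, Uc i q * FunctionSpaces.Torus.laplacian (φc n i q.1) q.2 ∂μ) atTop
      (𝓝 (∑ i, ∫ q, Uc i q * (∑ j, g3i i j q) ∂μ)) := by
    refine tendsto_finsetSum _ fun i _ => ?_
    have e : ∀ n, (fun q => Uc i q * FunctionSpaces.Torus.laplacian (φc n i q.1) q.2) =
        fun q => Uc i q * (∑ j, g3 n i j q) := fun n => by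
      funext q; rw [hdL n i q.1 q.2]
    simp_rw [e]
    exact tendsto_integral_mul_of_tendsto_eLpNorm_three (hU32' i) (hG3m · i) (hG3im i) (hG3conv i)
  ---------------------------------------------------------------- Term 4 (pressure)
  have hT4lim : Tendsto (fun n => ∫ q, stBarScalar T p q * ∑ i, FunctionSpaces.Torus.partialDeriv i (φc n i q.1) q.2 ∂μ) atTop
      (𝓝 (∫ q, stBarScalar T p q * ∑ i, ∑ j, g2i i i j q ∂μ)) := by
    have e : ∀ n, (fun q => stBarScalar T p q * ∑ i, FunctionSpaces.Torus.partialDeriv i (φc n i q.1) q.2) =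
        fun q => stBarScalar T p q * ∑ i, ∑ j, g2 n i i j q := fun n => by
      funext q
      congr 1
      exact Finset.sum_congr rfl fun i _ => hdx n i i q.1 q.2
    simp_rw [e]
    exact tendsto_integral_mul_of_tendsto_eLpNorm_three hpbar32 (fun n => Finset.aestronglyMeasurable_fun_sum _ fun i _ => hG2m n i i)
      (memLp_finsetSum Finset.univ fun i _ => hG2im i i)
      (tendsto_eLpNorm_finset_sum_sub (f := fun n i q => ∑ j, g2 n i i j q) (f₀ := fun i q => ∑ j, g2i i i j q)
        Finset.univ h13 (fun i _ => Eventually.of_forall fun n => (hG2m n i i).sub (hG2im i i).1)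
        fun i _ => hG2conv i i)
  ---------------------------------------------------------------- the limit identity on `ℝ × T^d`
  have hlimit : ∑ i, ∑ j, ∫ q, Uc i q * g1i i j q ∂μ + ∑ i, ∑ k, ∫ q, Uc i q * Uc k q * (∑ j, g2i i k j q) ∂μ +
      ν * ∑ i, ∫ q, Uc i q * (∑ j, g3i i j q) ∂μ + ∫ q, stBarScalar T p q * ∑ i, ∑ j, g2i i i j q ∂μ = 0 := by
    have h := ((hT1lim.add hT2lim).add (hT3lim.const_mul ν)).add hT4lim
    have e : (fun n => ∑ i, ∫ q, Uc i q * FunctionSpaces.Torus.timeDeriv (φc n i) q.1 q.2 ∂μ +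
        ∑ i, ∑ k, ∫ q, Uc i q * Uc k q * FunctionSpaces.Torus.partialDeriv k (φc n i q.1) q.2 ∂μ +
        ν * ∑ i, ∫ q, Uc i q * FunctionSpaces.Torus.laplacian (φc n i q.1) q.2 ∂μ +
        ∫ q, stBarScalar T p q * ∑ i, FunctionSpaces.Torus.partialDeriv i (φc n i q.1) q.2 ∂μ) = fun _ => (0 : ℝ) :=
      funext hEn
    rw [e] at h
    exact tendsto_nhds_unique h tendsto_const_nhds
  ------------------------------------------------------------------ identification of the limits
  haveI := FunctionSpaces.holderTriple_threeHalves_three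
  -- from integrals over `ℝ × T^d` to iterated integrals over `(0,T)`
  have hiter : ∀ {F : ℝ × UnitAddTorus d → ℝ} (_ : Integrable F μ) {G : ℝ → UnitAddTorus d → ℝ}
      (_ : ∀ᵐ t ∂(volume : Measure ℝ), (t ∈ Ioo 0 T → ∫ y, F (t, y) = ∫ y, G t y) ∧ (t ∉ Ioo 0 T → ∫ y, F (t, y) = 0)),
      ∫ q, F q ∂μ = ∫ t in Ioo 0 T, ∫ y, G t y := by
    intro F hF G hsl
    rw [integral_prod _ hF, ← integral_indicator measurableSet_Ioo]
    refine integral_congr_ae ?_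
    filter_upwards [hsl] with t ht
    by_cases hmem : t ∈ Ioo 0 T
    · rw [indicator_of_mem hmem, ht.1 hmem]
    · rw [indicator_of_notMem hmem, ht.2 hmem]
  -- a.e. slice data
  have hL3 : ∀ᵐ t ∂(volume.restrict (Ioo 0 T)), MemLp (u t) 3 volume := ae_memLp_three_of_lintegral hm hu3
  have hL1' : ∀ᵐ t ∂(volume : Measure ℝ), t ∈ Ioo 0 T → Integrable (u t) volume :=
    (ae_restrict_iff' measurableSet_Ioo).1 (hL3.mono fun t ht => ht.integrable (by norm_num))
  have hgoodt : ∀ᵐ t ∂(volume : Measure ℝ), (∀ j, (fun y => Uc j (t, y)) =ᵐ[volume] fun y => stBar T u (t, y) j) ∧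
      (t ∈ Ioo 0 T → Integrable (u t) volume) := (ae_slice_eq_of_ae_eq_stBar hUc).and hL1'
  -- slice-wise consequences at a good time inside `(0,T)`
  have hin : ∀ {t : ℝ} (_ : t ∈ Ioo 0 T) (_ : ∀ j, (fun y => Uc j (t, y)) =ᵐ[volume] fun y => stBar T u (t, y) j)
      (k : UnitAddTorus d → ℝ) (j : d),
      sliceConv (Uc j) k t = (fun y => u t y j) ⋆ k ∧ sliceConv (Ψ j) k t = (fun y => ψ t y * u t y j) ⋆ k ∧
        (∀ᵐ y ∂(volume : Measure (UnitAddTorus d)), Uc j (t, y) = u t y j) := by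
    intro t ht hs k j
    have hslice : (fun y => Uc j (t, y)) =ᵐ[volume] fun y => u t y j := by
      filter_upwards [hs j] with y hy
      rw [hy, stBar_apply_of_mem ht]
    have hsliceΨ : (fun y => Ψ j (t, y)) =ᵐ[volume] fun y => ψ t y * u t y j := by
      filter_upwards [hslice] with y hy
      simp only [hΨdef, hy]
    exact ⟨FunctionSpaces.Torus.convolution_congr_ae_left (ContinuousLinearMap.lsmul ℝ ℝ) hslice k,
      FunctionSpaces.Torus.convolution_congr_ae_left (ContinuousLinearMap.lsmul ℝ ℝ) hsliceΨ k, hslice⟩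
  have hout : ∀ {t : ℝ} (_ : t ∉ Ioo 0 T) (_ : ∀ j, (fun y => Uc j (t, y)) =ᵐ[volume] fun y => stBar T u (t, y) j) (j : d),
      ∀ᵐ y ∂(volume : Measure (UnitAddTorus d)), Uc j (t, y) = 0 := by
    intro t ht hs j
    filter_upwards [hs j] with y hy
    rw [hy, stBar_apply_of_not_mem ht]
    rfl
  ---------------------------------------------------------------- identification: Term 1
  have hI1 : ∑ i, ∑ j, ∫ q, Uc i q * g1i i j q ∂μ =
      ∫ t in Ioo 0 T, ∫ x, ⟪u t x, matConv (u t) M x⟫ * FunctionSpaces.Torus.timeDeriv ψ t x := by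
    have hFij : ∀ i j, Integrable (fun q => Uc i q * g1i i j q) μ := fun i j =>
      (hU32' i).integrable_mul (hmem_mul hcψtc hcψt (hmem (hUm j) (hU3 j) (hMc i j)))
    have hsum : ∑ i, ∑ j, ∫ q, Uc i q * g1i i j q ∂μ = ∫ q, ∑ i, ∑ j, Uc i q * g1i i j q ∂μ := by
      rw [integral_finsetSum _ fun i _ => integrable_finsetSum _ fun j _ => hFij i j]
      refine Finset.sum_congr rfl fun i _ => ?_
      rw [integral_finsetSum _ fun j _ => hFij i j]
    rw [hsum]
    refine hiter (integrable_finsetSum _ fun i _ => integrable_finsetSum _ fun j _ => hFij i j) ?_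
    filter_upwards [hgoodt] with t ht
    constructor
    · intro hmem
      refine integral_congr_ae ?_
      have hall : ∀ᵐ y ∂(volume : Measure (UnitAddTorus d)), ∀ j, Uc j (t, y) = u t y j :=
        ae_all_iff.2 fun j => (hin hmem ht.1 (M j j) j).2.2
      filter_upwards [hall] with y hy
      rw [PiLp.inner_apply, Finset.sum_mul]
      refine Finset.sum_congr rfl fun i _ => ?_
      have e1 : ∀ j, sliceConv (Uc j) (M i j) t = (fun y => u t y j) ⋆ M i j := fun j => (hin hmem ht.1 (M i j) j).1
      simp only [hg1i, hy i, e1, matConv_apply, RCLike.inner_apply, conj_trivial]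
      rw [Finset.sum_mul, Finset.sum_mul]
      exact Finset.sum_congr rfl fun j _ => by ring
    · intro hmem
      refine integral_eq_zero_of_ae ?_
      have hall : ∀ᵐ y ∂(volume : Measure (UnitAddTorus d)), ∀ j, Uc j (t, y) = 0 := ae_all_iff.2 fun j => hout hmem ht.1 j
      filter_upwards [hall] with y hy
      rw [Pi.zero_apply]
      exact Finset.sum_eq_zero fun i _ => Finset.sum_eq_zero fun j _ => by rw [hy i, zero_mul]
  ---------------------------------------------------------------- identification: Term 2
  have hI2 : ∑ i, ∑ k, ∫ q, Uc i q * Uc k q * (∑ j, g2i i k j q) ∂μ =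
      ∫ t in Ioo 0 T, ∫ x, ⟪u t x, FunctionSpaces.Torus.convect (u t) (matSymmTestField M (ψ t) (u t)) x⟫ := by
    have hFik : ∀ i k, Integrable (fun q => Uc i q * Uc k q * (∑ j, g2i i k j q)) μ := fun i k =>
      (hU32 i k).integrable_mul (hG2im i k)
    have hsum : ∑ i, ∑ k, ∫ q, Uc i q * Uc k q * (∑ j, g2i i k j q) ∂μ =
        ∫ q, ∑ i, ∑ k, Uc i q * Uc k q * (∑ j, g2i i k j q) ∂μ := by
      rw [integral_finsetSum _ fun i _ => integrable_finsetSum _ fun k _ => hFik i k]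
      refine Finset.sum_congr rfl fun i _ => ?_
      rw [integral_finsetSum _ fun k _ => hFik i k]
    rw [hsum]
    refine hiter (integrable_finsetSum _ fun i _ => integrable_finsetSum _ fun k _ => hFik i k) ?_
    filter_upwards [hgoodt] with t ht
    constructor
    · intro hmem
      have hut : Integrable (u t) volume := ht.2 hmem
      have hΦ1 : FunctionSpaces.Torus.IsContDiff 1 (matSymmTestField M (ψ t) (u t)) :=
        (isSmooth_matSymmTestField hM (hψslice t) hut).isContDiff (by simp)
      refine integral_congr_ae ?_
      have hall : ∀ᵐ y ∂(volume : Measure (UnitAddTorus d)), ∀ j, Uc j (t, y) = u t y j :=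
        ae_all_iff.2 fun j => (hin hmem ht.1 (M j j) j).2.2
      filter_upwards [hall] with y hy
      rw [inner_convect_eq_sum hΦ1 (u t y) (u t) y]
      refine Finset.sum_congr rfl fun i _ => ?_
      rw [Finset.mul_sum]
      refine Finset.sum_congr rfl fun k _ => ?_
      have e1 : ∀ (kk : UnitAddTorus d → ℝ) j, sliceConv (Uc j) kk t = (fun y => u t y j) ⋆ kk := fun kk j =>
        (hin hmem ht.1 kk j).1
      have e2 : ∀ (kk : UnitAddTorus d → ℝ) j, sliceConv (Ψ j) kk t = (fun y => ψ t y * u t y j) ⋆ kk := fun kk j =>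
        (hin hmem ht.1 kk j).2.1
      rw [partialDeriv_matSymmTestField_eq_sum hM (hψslice t) hut k i y]
      simp only [hg2i, hy i, hy k, e1, e2]
      ring
    · intro hmem
      refine integral_eq_zero_of_ae ?_
      have hall : ∀ᵐ y ∂(volume : Measure (UnitAddTorus d)), ∀ j, Uc j (t, y) = 0 := ae_all_iff.2 fun j => hout hmem ht.1 j
      filter_upwards [hall] with y hy
      rw [Pi.zero_apply]
      exact Finset.sum_eq_zero fun i _ => Finset.sum_eq_zero fun k _ => by rw [hy i, zero_mul, zero_mul]
  ---------------------------------------------------------------- identification: Term 3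
  have hI3 : ∑ i, ∫ q, Uc i q * (∑ j, g3i i j q) ∂μ =
      ∫ t in Ioo 0 T, ∫ x, ⟪u t x, FunctionSpaces.Torus.laplacian (matSymmTestField M (ψ t) (u t)) x⟫ := by
    have hFi : ∀ i, Integrable (fun q => Uc i q * (∑ j, g3i i j q)) μ := fun i => (hU32' i).integrable_mul (hG3im i)
    rw [← integral_finsetSum _ fun i _ => hFi i]
    refine hiter (integrable_finsetSum _ fun i _ => hFi i) ?_
    filter_upwards [hgoodt] with t ht
    constructor
    · intro hmem
      have hut : Integrable (u t) volume := ht.2 hmem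
      refine integral_congr_ae ?_
      have hall : ∀ᵐ y ∂(volume : Measure (UnitAddTorus d)), ∀ j, Uc j (t, y) = u t y j :=
        ae_all_iff.2 fun j => (hin hmem ht.1 (M j j) j).2.2
      filter_upwards [hall] with y hy
      rw [inner_laplacian_matSymmTestField_eq_sum hM (hψslice t) hut (u t y) y]
      refine Finset.sum_congr rfl fun i _ => ?_
      have e1 : ∀ (kk : UnitAddTorus d → ℝ) j, sliceConv (Uc j) kk t = (fun y => u t y j) ⋆ kk := fun kk j =>
        (hin hmem ht.1 kk j).1
      have e2 : ∀ (kk : UnitAddTorus d → ℝ) j, sliceConv (Ψ j) kk t = (fun y => ψ t y * u t y j) ⋆ kk := fun kk j =>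
        (hin hmem ht.1 kk j).2.1
      rw [laplacian_matSymmTestField_apply hM (hψslice t) hut i y]
      simp only [hg3i, hy i, e1, e2]
    · intro hmem
      refine integral_eq_zero_of_ae ?_
      have hall : ∀ᵐ y ∂(volume : Measure (UnitAddTorus d)), ∀ j, Uc j (t, y) = 0 := ae_all_iff.2 fun j => hout hmem ht.1 j
      filter_upwards [hall] with y hy
      rw [Pi.zero_apply]
      exact Finset.sum_eq_zero fun i _ => by rw [hy i, zero_mul]
  ---------------------------------------------------------------- identification: Term 4
  have hI4 : ∫ q, stBarScalar T p q * ∑ i, ∑ j, g2i i i j q ∂μ =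
      ∫ t in Ioo 0 T, ∫ x, p t x * FunctionSpaces.Torus.divergence (matSymmTestField M (ψ t) (u t)) x := by
    have hF : Integrable (fun q => stBarScalar T p q * ∑ i, ∑ j, g2i i i j q) μ :=
      hpbar32.integrable_mul (memLp_finsetSum Finset.univ fun i _ => hG2im i i)
    refine hiter hF ?_
    filter_upwards [hgoodt] with t ht
    constructor
    · intro hmem
      have hut : Integrable (u t) volume := ht.2 hmem
      refine integral_congr_ae ?_
      have hall : ∀ᵐ y ∂(volume : Measure (UnitAddTorus d)), ∀ j, Uc j (t, y) = u t y j :=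
        ae_all_iff.2 fun j => (hin hmem ht.1 (M j j) j).2.2
      filter_upwards [hall] with y hy
      rw [stBarScalar_apply_of_mem hmem, divergence_matSymmTestField_eq_sum hM (hψslice t) hut y]
      congr 1
      refine Finset.sum_congr rfl fun i _ => ?_
      have e1 : ∀ (kk : UnitAddTorus d → ℝ) j, sliceConv (Uc j) kk t = (fun y => u t y j) ⋆ kk := fun kk j =>
        (hin hmem ht.1 kk j).1
      have e2 : ∀ (kk : UnitAddTorus d → ℝ) j, sliceConv (Ψ j) kk t = (fun y => ψ t y * u t y j) ⋆ kk := fun kk j =>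
        (hin hmem ht.1 kk j).2.1
      simp only [hg2i, e1, e2]
    · intro hmem
      refine integral_eq_zero_of_ae (Eventually.of_forall fun y => ?_)
      show stBarScalar T p (t, y) * ∑ i, ∑ j, g2i i i j (t, y) = 0
      rw [stBarScalar_apply_of_not_mem hmem, zero_mul]
  ---------------------------------------------------------------- conclusion
  rw [hI1, hI2, hI3, hI4] at hlimit
  exact hlimit

end Discharge

end Literature.Analysis.FluidPDE.Torus
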